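import Literature.RepresentationTheory.ModularTensorCategories.TemperleyLieb.Basic

/-!
# Temperley–Lieb recoupling theory (3/6): Negligible morphisms, 3-vertices, vertex uniqueness, the bent vertex; The θ-net recursion and formula; morphisms through small projectors

Part of the sorry-free formalization of Kauffman–Lins' recoupling theory in the binor model
(definitions and overview: `TemperleyLieb/Defs.lean`). Theorem-only file.

## References
* L. H. Kauffman, S. Lins, *Temperley–Lieb Recoupling Theory and Invariants of 3-Manifolds* (1994). [KauffmanLins1994]
* G. Masbaum, P. Vogel, *3-valent graphs and the Kauffman bracket*, Pacific J. Math. 164 (1994). [MasbaumVogel1994]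
-/

noncomputable section

open BigOperators Finset

namespace Literature.RepresentationTheory.ModularTensorCategories

namespace TemperleyLieb

variable {K : Type*} [Field K]
variable {m n p m' n' p' m'' n'' : ℕ}

open Mor

variable {A : K}

namespace Neg

variable {A : K}

/-- Bookkeeping lemma `isTL` of the binor tensor model of Temperley–Lieb recoupling theory (conventions of KL94 §8.2, §9). [folklore] -/
theorem isTL {N : Mor K m n} (h : N ∈ Neg A m n) : IsTL A N := h.1

/-- Bookkeeping lemma `trAll_eq_zero` of the binor tensor model of Temperley–Lieb recoupling theory (conventions of KL94 §8.2, §9). [folklore] -/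
theorem trAll_eq_zero {N : Mor K m n} (h : N ∈ Neg A m n) {Y : Mor K n m} (hY : IsTL A Y) :
    trAll A (Y ⊚ N) = 0 := h.2 Y hY

/-- Bookkeeping lemma `mk` of the binor tensor model of Temperley–Lieb recoupling theory (conventions of KL94 §8.2, §9). [folklore] -/
theorem mk {N : Mor K m n} (hN : IsTL A N) (h : ∀ Y : Mor K n m, IsTL A Y → trAll A (Y ⊚ N) = 0) :
    N ∈ Neg A m n := ⟨hN, h⟩

/-- Bookkeeping lemma `trAll_self` of the binor tensor model of Temperley–Lieb recoupling theory (conventions of KL94 §8.2, §9). [folklore] -/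
theorem trAll_self {N : Mor K n n} (h : N ∈ Neg A n n) : trAll A N = 0 := by
  have := h.2 (idm n) (IsTL.idm n); rwa [idm_comp] at this

/-- Bookkeeping lemma `comp_mem` of the binor tensor model of Temperley–Lieb recoupling theory (conventions of KL94 §8.2, §9). [folklore] -/
theorem comp_mem {N : Mor K m n} (h : N ∈ Neg A m n) {X : Mor K n p} (hX : IsTL A X) : X ⊚ N ∈ Neg A m p :=
  ⟨hX.comp _ h.1, fun Y hY => by rw [comp_assoc]; exact h.2 _ (hY.comp _ hX)⟩

/-- Bookkeeping lemma `mem_comp` of the binor tensor model of Temperley–Lieb recoupling theory (conventions of KL94 §8.2, §9). [folklore] -/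
theorem mem_comp (hA : A ≠ 0) {N : Mor K m n} (h : N ∈ Neg A m n) {Z : Mor K p m} (hZ : IsTL A Z) :
    N ⊚ Z ∈ Neg A p n :=
  ⟨h.1.comp _ hZ, fun Y hY => by
    rw [comp_assoc, trAll_comp_comm hA (hY.comp _ h.1), comp_assoc]
    exact h.2 _ (hZ.comp _ hY)⟩

/-- Bookkeeping lemma `cast_mem` of the binor tensor model of Temperley–Lieb recoupling theory (conventions of KL94 §8.2, §9). [folklore] -/
theorem cast_mem {N : Mor K m n} (h : N ∈ Neg A m n) (hm : m = m') (hn : n = n') :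
    N.cast hm hn ∈ Neg A m' n' := by
  subst hm hn; exact h

/-- Bookkeeping lemma `tens_idm_one_mem` of the binor tensor model of Temperley–Lieb recoupling theory (conventions of KL94 §8.2, §9). [folklore] -/
theorem tens_idm_one_mem {N : Mor K m n} (h : N ∈ Neg A m n) : N ⊗ₘ idm 1 ∈ Neg A (m + 1) (n + 1) :=
  ⟨h.1.tens_idm 1, fun Y hY => by rw [trAll_succ, rptr_comp_tens_idm]; exact h.2 _ hY.rptr⟩

/-- Bookkeeping lemma `tens_idm_mem` of the binor tensor model of Temperley–Lieb recoupling theory (conventions of KL94 §8.2, §9). [folklore] -/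
theorem tens_idm_mem {N : Mor K m n} (h : N ∈ Neg A m n) : ∀ k : ℕ, N ⊗ₘ idm k ∈ Neg A (m + k) (n + k)
  | 0 => by rw [tens_idm_zero]; exact h
  | k + 1 => by rw [tens_idm_succ]; exact Neg.tens_idm_one_mem (tens_idm_mem h k)

/-- Bookkeeping lemma `idm_one_tens_mem` of the binor tensor model of Temperley–Lieb recoupling theory (conventions of KL94 §8.2, §9). [folklore] -/
theorem idm_one_tens_mem (hA : A ≠ 0) {N : Mor K m n} (h : N ∈ Neg A m n) :
    (idm 1 ⊗ₘ N :).cast (Nat.add_comm 1 m) (Nat.add_comm 1 n) ∈ Neg A (m + 1) (n + 1) :=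
  ⟨(h.1.idm_tens 1).cast _ _, fun Y hY => by
    rw [← trAll_lptr hA (hY.comp _ ((h.1.idm_tens 1).cast _ _)), lptr_comp_idm_one_tens]
    exact h.2 _ hY.lptr⟩

/-- Bookkeeping lemma `idm_tens_mem` of the binor tensor model of Temperley–Lieb recoupling theory (conventions of KL94 §8.2, §9). [folklore] -/
theorem idm_tens_mem (hA : A ≠ 0) {N : Mor K m n} (h : N ∈ Neg A m n) : ∀ k : ℕ, idm k ⊗ₘ N ∈ Neg A (k + m) (k + n)
  | 0 => by rw [idm_zero_tens]; exact Neg.cast_mem h _ _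
  | k + 1 => by
    have h1 := Neg.idm_one_tens_mem hA (idm_tens_mem hA h k)
    have e : (idm (k + 1) ⊗ₘ N : Mor K _ _) = ((idm 1 ⊗ₘ (idm k ⊗ₘ N) :).cast (Nat.add_comm 1 _)
        (Nat.add_comm 1 _)).cast (by omega) (by omega) := by
      apply ext'
      rw [cast_val, cast_val, tens_val, tens_val, tens_val, idm_val, idm_val, idm_val, tensR_assoc,
        tensR_idR_idR, Nat.add_comm 1 k]
    rw [e]
    exact Neg.cast_mem h1 _ _

/-- The two-sided tensor ideal property: `𝟙_k ⊗ N ⊗ 𝟙_k'` is negligible. [cite: KauffmanLins1994, §7.1] -/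
theorem idm_tens_tens_idm_mem (hA : A ≠ 0) {N : Mor K m n} (h : N ∈ Neg A m n) (k k' : ℕ) :
    idm k ⊗ₘ N ⊗ₘ idm k' ∈ Neg A (k + m + k') (k + n + k') :=
  Neg.tens_idm_mem (idm_tens_mem hA h k) k'

end Neg

namespace Mor

/-- A projector of trace zero is negligible: `f_n ∈ Neg` when `Δ_n = 0` (the case `n = r - 1` at
`q = e^{iπ/r}`). [cite: KauffmanLins1994, §5.1 Lemma 5] -/
theorem jw_mem_neg (hA : A ≠ 0) (hg : Good A n) (hΔ : Delta A n = 0) : jw A n ∈ Neg A n n :=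
  Neg.mk (IsTL.jw n) (fun Y hY => by
    obtain ⟨c, hc⟩ := comp_jw_eq_smul hA hY hg
    rw [hc, trAll_smul, trAll_jw hA n hg, hΔ, mul_zero])

end Mor

/-! ### Three-vertices -/

namespace Mor

variable (A : K)


variable {A}

/-- Bookkeeping lemma `stdCups` of the binor tensor model of Temperley–Lieb recoupling theory (conventions of KL94 §8.2, §9). [folklore] -/
theorem _root_.Literature.RepresentationTheory.ModularTensorCategories.TemperleyLieb.IsTL.stdCups (x y : ℕ) :
    ∀ z : ℕ, IsTL A (stdCups A x y z)
  | 0 => IsTL.idm _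
  | z + 1 => ((IsTL.cupAt _ _).comp _ (IsTL.stdCups x y z)).cast _ _

/-- Bookkeeping lemma `vert` of the binor tensor model of Temperley–Lieb recoupling theory (conventions of KL94 §8.2, §9). [folklore] -/
theorem _root_.Literature.RepresentationTheory.ModularTensorCategories.TemperleyLieb.IsTL.vert (x z y : ℕ) :
    IsTL A (vert A x z y) :=
  (((IsTL.jw _).tens (IsTL.jw _)).comp _ (IsTL.stdCups x y z)).comp _ (IsTL.jw _)

/-- Bookkeeping lemma `jw_val_congr` of the binor tensor model of Temperley–Lieb recoupling theory (conventions of KL94 §8.2, §9). [folklore] -/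
theorem jw_val_congr {a a' : ℕ} (h : a = a') : (jw A a).val = (jw A a').val := by subst h; rfl

/-- Left absorption in the `n + 1` form: `f_{n+1} (𝟙 ⊗ f_n) = f_{n+1}`. [folklore] -/
theorem jw_comp_idm_one_tens_jw (hA : A ≠ 0) (n : ℕ) (hg : Good A (n + 1)) :
    jw A (n + 1) ⊚ (idm 1 ⊗ₘ jw A n :).cast (Nat.add_comm 1 n) (Nat.add_comm 1 n) = jw A (n + 1) := by
  have h := jw_comp_idm_tens_jw hA 1 n (by rwa [Nat.add_comm])
  have key : ∀ (m : ℕ) (e : 1 + n = m), jw A m ⊚ (idm 1 ⊗ₘ jw A n :).cast e e = jw A m := by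
    intro m e; subst e; exact h
  exact key (n + 1) (Nat.add_comm 1 n)

/-- The straddling cup absorbs the smaller projectors:
`(f_{a+1} ⊗ f_{b+1}) ∪_a = (f_{a+1} ⊗ f_{b+1}) ∪_a (f_a ⊗ f_b)`. [cite: KauffmanLins1994, §9.9] -/
theorem jw_tens_jw_comp_cupAt_straddle (hA : A ≠ 0) (a b : ℕ) (hga : Good A (a + 1)) (hgb : Good A (b + 1)) :
    (jw A (a + 1) ⊗ₘ jw A (b + 1)) ⊚ (cupAt A (a + b) a).cast rfl (by omega) =
      (jw A (a + 1) ⊗ₘ jw A (b + 1)) ⊚ (cupAt A (a + b) a).cast rfl (by omega) ⊚ (jw A a ⊗ₘ jw A b) := by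
  have h1 := congrArg Mor.val (jw_absorb_right hA hga)
  have h2 := congrArg Mor.val (jw_comp_idm_one_tens_jw hA b hgb)
  rw [comp_val, tens_val, idm_val] at h1
  rw [comp_val, cast_val, tens_val, idm_val] at h2
  apply ext'
  rw [comp_val, comp_val, comp_val, cast_val, tens_val, tens_val, cupAt_val A (Nat.le_add_right a b),
    Nat.add_sub_cancel_left]
  unfold block
  simp only [Nat.add_zero]
  conv_lhs => rw [← h1, ← h2]
  rw [← compR_tensR_tensR (jw A (a + 1)).respC ((jw A a).respR.tensR (RespR.idR 1) a)]
  simp only [← compR_assoc]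
  congr 1
  -- both sides are `(f_a ⊗ ∪ ⊗ f_b)`
  rw [tensR_assoc, ← tensR_assoc (X := (jw A a).val), tensR_idR_idR]
  simp only [Nat.reduceAdd]
  rw [show a + 1 + (b + 1) = a + 1 + 1 + b by omega,
    compR_tensR_tensR ((jw A a).respC.tensR (RespC.idR 2) a) ((RespR.idR a).tensR (RespR.cupR A) a),
    compR_idR (jw A b).respC, show a + 1 + 1 = a + 2 from rfl,
    compR_tensR_tensR (jw A a).respC (RespR.idR a), compR_idR (jw A a).respC, idR_compR (RespR.cupR A),
    compR_tensR_tensR (respC_idR_cupR a) (jw A a).respR, idR_compR (jw A b).respR,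
    ← tensR_idR_zero (n := a) (m := a) (jw A a).val, compR_tensR_tensR_zero (RespC.idR a) (jw A a).respR,
    idR_compR (jw A a).respR, compR_idR (RespC.cupR A 0), tensR_idR_zero]

end Mor

namespace Mor

/-- Bookkeeping lemma `comp_cast_left` of the binor tensor model of Temperley–Lieb recoupling theory (conventions of KL94 §8.2, §9). [folklore] -/
theorem comp_cast_left (X : Mor K n p) (Y : Mor K m n) (hp : p = p') :
    (X ⊚ Y).cast rfl hp = X.cast rfl hp ⊚ Y := by subst hp; rfl

/-- A cup inside the left block is killed: `(f_{a+2} ⊗ f_b) ∪_i = 0` for `i ≤ a`. [folklore] -/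
theorem jw_tens_jw_comp_cupAt_left (hA : A ≠ 0) {a b i : ℕ} (hi : i ≤ a) (hg : Good A (a + 2))
    (h : a + b + 2 = a + 2 + b) :
    (jw A (a + 2) ⊗ₘ jw A b) ⊚ (cupAt A (a + b) i).cast rfl h = 0 := by
  have e : (cupAt A (a + b) i).cast rfl h = cupAt A a i ⊗ₘ idm b :=
    ext' (by rw [cast_val]; exact (cupAt_add_val A hi b).symm)
  rw [e, tens_comp_tens, jw_comp_cupAt hA hg hi, zero_tens]

/-- A cup inside the right block is killed: `(f_a ⊗ f_{b+2}) ∪_{a+i} = 0` for `i ≤ b`. [folklore] -/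
theorem jw_tens_jw_comp_cupAt_right (hA : A ≠ 0) {a b i : ℕ} (hi : i ≤ b) (hg : Good A (b + 2))
    (h : a + b + 2 = a + (b + 2)) :
    (jw A a ⊗ₘ jw A (b + 2)) ⊚ (cupAt A (a + b) (a + i)).cast rfl h = 0 := by
  have e : (cupAt A (a + b) (a + i)).cast rfl h = idm a ⊗ₘ cupAt A b i :=
    ext' (by rw [cast_val]; exact (idm_tens_cupAt_val A a hi).symm)
  rw [e, tens_comp_tens, jw_comp_cupAt hA hg hi, tens_zero]

end Mor


/-- **Nesting lemma**: sandwiching a composite of cups between `f_a ⊗ f_b` and `f_c` gives a multiple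
of the 3-vertex (each cup, from the outermost inwards, must straddle the two blocks, else it is
killed). [cite: KauffmanLins1994, §7.1 (proof of Lemma 17), §9.9] -/
theorem nest (hA : A ≠ 0) {c N : ℕ} {C : Mor K c N} (hC : IsCups A C) :
    ∀ (a b : ℕ) (h : N = a + b), Good A a → Good A b →
      (jw A a ⊗ₘ jw A b) ⊚ C.cast rfl h ⊚ jw A c ∈ vertSpan A a b c := by
  induction hC with
  | idm =>
    intro a b h hga hgb
    subst h
    rw [Mor.cast_eq_self, comp_idm]
    refine Submodule.subset_span ⟨a, b, 0, rfl, rfl, rfl, ext' ?_⟩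
    rw [cast_val, vert_def, stdCups_zero, comp_val, comp_val, comp_val, tens_val, tens_val, idm_val,
      jw_val_congr (Nat.add_zero a), jw_val_congr (Nat.add_zero b)]
    simp only [Nat.add_zero]
    rw [compR_idR ((jw A a).respC.tensR (jw A b).respC a)]
  | @cup_comp N' i hi C' hC' ih =>
    intro a b h hga hgb
    rw [comp_cast_left, comp_assoc]
    rcases Nat.lt_or_ge (i + 1) a with h1 | h1
    · -- the cup lies inside the left block
      obtain ⟨a₀, rfl⟩ : ∃ a₀, a = a₀ + 2 := ⟨a - 2, by omega⟩
      obtain rfl : N' = a₀ + b := by omega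
      rw [jw_tens_jw_comp_cupAt_left hA (by omega) hga, zero_comp, zero_comp]
      exact Submodule.zero_mem _
    · rcases Nat.lt_or_ge i a with h2 | h2
      · -- the cup straddles
        obtain ⟨a', rfl⟩ : ∃ a', a = a' + 1 := ⟨i, by omega⟩
        obtain rfl : i = a' := by omega
        obtain ⟨b', rfl⟩ : ∃ b', b = b' + 1 := ⟨b - 1, by omega⟩
        obtain rfl : N' = i + b' := by omega
        rw [jw_tens_jw_comp_cupAt_straddle hA i b' hga hgb,
          ← comp_assoc _ (jw A i ⊗ₘ jw A b') C', ← comp_assoc _ ((jw A i ⊗ₘ jw A b') ⊚ C') (jw A _)]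
        have key : vertSpan A i b' c ≤ (vertSpan A (i + 1) (b' + 1) c).comap
            (compLeftL ((jw A (i + 1) ⊗ₘ jw A (b' + 1)) ⊚ (cupAt A (i + b') i).cast rfl (by omega))) := by
          rw [vertSpan, Submodule.span_le]
          rintro _ ⟨x, y, z, hc, hab, hx, rfl⟩
          subst hx
          obtain rfl : b' = y + z := by omega
          simp only [Submodule.comap_coe, Set.mem_preimage, compLeftL_apply, SetLike.mem_coe]
          refine Submodule.subset_span ⟨x, y, z + 1, hc, by omega, by omega, ?_⟩
          subst hc
          rw [Mor.cast_eq_self, vert_def A x z y, comp_assoc, comp_assoc,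
            ← jw_tens_jw_comp_cupAt_straddle hA (x + z) (y + z) hga hgb]
          apply ext'
          simp only [cast_val, comp_val, vert_def, stdCups_succ, tens_val, compR_assoc]
          rfl
        exact key (by
          simpa [Mor.cast_eq_self] using ih i b' rfl (hga.mono (Nat.le_succ _)) (hgb.mono (Nat.le_succ _)))
      · -- the cup lies inside the right block
        obtain ⟨i', rfl⟩ : ∃ i', i = a + i' := ⟨i - a, by omega⟩
        obtain ⟨b₀, rfl⟩ : ∃ b₀, b = b₀ + 2 := ⟨b - 2, by omega⟩
        obtain rfl : N' = a + b₀ := by omega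
        rw [jw_tens_jw_comp_cupAt_right hA (by omega) hgb, zero_comp, zero_comp]
        exact Submodule.zero_mem _


/-! ### Lemma 1 (left version), vertex uniqueness, dual vertices, the bubble -/

namespace Mor

/-- **Lemma 1, left-handed**: closing the first strand of `f_{n+1}` gives `(Δ_{n+1}/Δ_n) f_n`.
[cite: KauffmanLins1994, §9.8; MasbaumVogel1994, Lemma 1] -/
theorem lptr_jw (hA : A ≠ 0) (hg : Good A (n + 1)) :
    lptr A (jw A (n + 1)) = (Delta A (n + 1) / Delta A n) • jw A n := by
  have hL : lptr A (jw A (n + 1)) ⊚ jw A n = lptr A (jw A (n + 1)) := by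
    rw [← lptr_comp_idm_one_tens, jw_comp_idm_one_tens_jw hA n hg]
  obtain ⟨c, hc⟩ := comp_jw_eq_smul hA (IsTL.jw (n + 1)).lptr (hg.mono (Nat.le_succ n))
  rw [hL] at hc
  have ht : trAll A (lptr A (jw A (n + 1))) = Delta A (n + 1) := by
    rw [trAll_lptr hA (IsTL.jw _), trAll_jw hA _ hg]
  rw [hc, trAll_smul, trAll_jw hA n (hg.mono (Nat.le_succ n))] at ht
  rw [hc, eq_div_of_mul_eq (hg n (Nat.lt_succ_self n)) ht]

/-- Bookkeeping lemma `trAll_trpm` of the binor tensor model of Temperley–Lieb recoupling theory (conventions of KL94 §8.2, §9). [folklore] -/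
theorem trAll_trpm (X : Mor K n n) : trAll A (trpm X) = trAll A X := by
  rw [trAll_eq_trW, trAll_eq_trW, trpm_val]; rfl

/-- Bookkeeping lemma `trpm_cast` of the binor tensor model of Temperley–Lieb recoupling theory (conventions of KL94 §8.2, §9). [folklore] -/
theorem trpm_cast (X : Mor K m n) (hm : m = m') (hn : n = n') :
    trpm (X.cast hm hn) = (trpm X).cast hn hm := by subst hm hn; rfl


/-- Bookkeeping lemma `cast_neg` of the binor tensor model of Temperley–Lieb recoupling theory (conventions of KL94 §8.2, §9). [folklore] -/
theorem cast_neg (X : Mor K m n) (hm : m = m') (hn : n = n') : (-X).cast hm hn = -X.cast hm hn := by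
  subst hm hn; rfl

/-- Bookkeeping lemma `comp_cast_right` of the binor tensor model of Temperley–Lieb recoupling theory (conventions of KL94 §8.2, §9). [folklore] -/
theorem comp_cast_right (X : Mor K n p) (Y : Mor K m n) (hm : m = m') :
    (X ⊚ Y).cast hm rfl = X ⊚ Y.cast hm rfl := by subst hm; rfl

end Mor

/-- The vertex span over an admissible triple is the line through the 3-vertex. [cite: KauffmanLins1994, §9.9] -/
theorem vertSpan_eq_span (A : K) (x z y : ℕ) :
    vertSpan A (x + z) (y + z) (x + y) = K ∙ vert A x z y := by
  unfold vertSpan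
  congr 1
  ext V
  simp only [Set.mem_setOf_eq, Set.mem_singleton_iff]
  constructor
  · rintro ⟨x', y', z', hc, hab, hx, rfl⟩
    obtain rfl : x' = x := by omega
    obtain rfl : z' = z := by omega
    obtain rfl : y' = y := by omega
    rfl
  · rintro rfl
    exact ⟨x, y, z, rfl, rfl, rfl, rfl⟩

/-- The vertex span over a non-admissible triple is zero. [cite: KauffmanLins1994, §9.9] -/
theorem vertSpan_eq_bot (A : K) {a b c : ℕ} (h : ∀ x y z : ℕ, x + y = c → x + z = a → y + z ≠ b) :
    vertSpan A a b c = ⊥ := by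
  have he : {V : Mor K c (a + b) | ∃ (x y z : ℕ) (hc : x + y = c) (hab : (x + z) + (y + z) = a + b),
      a = x + z ∧ V = (vert A x z y).cast hc hab} = ∅ := by
    refine Set.eq_empty_iff_forall_notMem.mpr ?_
    rintro V ⟨x, y, z, hc, hab, hx, -⟩
    exact h x y z hc hx.symm (by omega)
  rw [vertSpan, he, Submodule.span_empty]

/-- **Vertex uniqueness** (span form): `(f_a ⊗ f_b) X f_c` lies on the vertex line for every
Temperley–Lieb `X : c → a ⊗ b`. [cite: KauffmanLins1994, §9.9, §7.1 Lemma 17] -/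
theorem sandwich_mem_vertSpan (hA : A ≠ 0) {a b c : ℕ} {X : Mor K c (a + b)} (hX : IsTL A X)
    (hga : Good A a) (hgb : Good A b) (hgc : Good A c) :
    (jw A a ⊗ₘ jw A b) ⊚ X ⊚ jw A c ∈ vertSpan A a b c := by
  have h := comp_jw_mem_cupSpan hA hX hgc
  have key : cupSpan A c (a + b) ≤ (vertSpan A a b c).comap (compLeftL (jw A a ⊗ₘ jw A b)) := by
    rw [cupSpan, Submodule.span_le]
    rintro _ ⟨C, hC, rfl⟩
    simp only [Submodule.comap_coe, Set.mem_preimage, compLeftL_apply, SetLike.mem_coe, comp_assoc]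
    simpa [cast_eq_self] using nest hA hC a b rfl hga hgb
  have h2 := key h
  rw [Submodule.mem_comap, compLeftL_apply, comp_assoc] at h2
  exact h2

/-- **Vertex uniqueness**: `(f_{x+z} ⊗ f_{y+z}) X f_{x+y} = κ · (vertex)`. [cite: KauffmanLins1994, §9.9] -/
theorem sandwich_eq_smul_vert (hA : A ≠ 0) (x z y : ℕ) {X : Mor K (x + y) ((x + z) + (y + z))}
    (hX : IsTL A X) (hga : Good A (x + z)) (hgb : Good A (y + z)) (hgc : Good A (x + y)) :
    ∃ κ : K, (jw A (x + z) ⊗ₘ jw A (y + z)) ⊚ X ⊚ jw A (x + y) = κ • vert A x z y := by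
  have h := sandwich_mem_vertSpan hA hX hga hgb hgc
  rw [vertSpan_eq_span, Submodule.mem_span_singleton] at h
  obtain ⟨κ, hκ⟩ := h
  exact ⟨κ, hκ.symm⟩

/-- **Vertex vanishing**: `(f_a ⊗ f_b) X f_c = 0` when `(a, b, c)` is not admissible. [cite: KauffmanLins1994, §9.9] -/
theorem sandwich_eq_zero (hA : A ≠ 0) {a b c : ℕ} {X : Mor K c (a + b)} (hX : IsTL A X)
    (hga : Good A a) (hgb : Good A b) (hgc : Good A c)
    (h : ∀ x y z : ℕ, x + y = c → x + z = a → y + z ≠ b) :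
    (jw A a ⊗ₘ jw A b) ⊚ X ⊚ jw A c = 0 := by
  have h' := sandwich_mem_vertSpan hA hX hga hgb hgc
  rwa [vertSpan_eq_bot A h, Submodule.mem_bot] at h'

namespace Mor

variable (A : K)


variable {A}

/-- Bookkeeping lemma `stdCaps` of the binor tensor model of Temperley–Lieb recoupling theory (conventions of KL94 §8.2, §9). [folklore] -/
theorem _root_.Literature.RepresentationTheory.ModularTensorCategories.TemperleyLieb.IsTL.stdCaps (x y : ℕ) :
    ∀ z : ℕ, IsTL A (stdCaps A x y z)
  | 0 => IsTL.idm _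
  | z + 1 => ((IsTL.stdCaps x y z).comp _ (IsTL.capAt _ _)).cast _ _

/-- Bookkeeping lemma `dvert` of the binor tensor model of Temperley–Lieb recoupling theory (conventions of KL94 §8.2, §9). [folklore] -/
theorem _root_.Literature.RepresentationTheory.ModularTensorCategories.TemperleyLieb.IsTL.dvert (x z y : ℕ) :
    IsTL A (dvert A x z y) :=
  ((IsTL.jw _).comp _ (IsTL.stdCaps x y z)).comp _ ((IsTL.jw _).tens (IsTL.jw _))

/-- Bookkeeping lemma `thetaCore` of the binor tensor model of Temperley–Lieb recoupling theory (conventions of KL94 §8.2, §9). [folklore] -/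
theorem _root_.Literature.RepresentationTheory.ModularTensorCategories.TemperleyLieb.IsTL.thetaCore (x z y : ℕ) :
    IsTL A (thetaCore A x z y) :=
  (((IsTL.stdCaps x y z).comp _ ((IsTL.jw _).tens (IsTL.jw _))).comp _ (IsTL.stdCups x y z)).comp _
    (IsTL.jw _)

/-- Bookkeeping lemma `trpm_stdCups` of the binor tensor model of Temperley–Lieb recoupling theory (conventions of KL94 §8.2, §9). [folklore] -/
theorem trpm_stdCups (x y : ℕ) : ∀ z : ℕ, trpm (stdCups A x y z) = ((-1 : K) ^ z) • stdCaps A x y z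
  | 0 => by rw [stdCups_zero, stdCaps_zero, trpm_idm, pow_zero, one_smul]
  | z + 1 => by
    rw [stdCups_succ, trpm_cast, trpm_comp, trpm_stdCups x y z, trpm_cupAt, smul_comp, comp_neg,
      stdCaps_succ, cast_smul, pow_succ, mul_neg_one, neg_smul, cast_neg, smul_neg]

/-- Bookkeeping lemma `trpm_stdCaps` of the binor tensor model of Temperley–Lieb recoupling theory (conventions of KL94 §8.2, §9). [folklore] -/
theorem trpm_stdCaps (x y z : ℕ) : trpm (stdCaps A x y z) = ((-1 : K) ^ z) • stdCups A x y z := by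
  have h := congrArg trpm (trpm_stdCups (A := A) x y z)
  rw [trpm_trpm, trpm_smul] at h
  calc trpm (stdCaps A x y z) = ((-1 : K) ^ z * (-1) ^ z) • trpm (stdCaps A x y z) := by
        rw [← mul_pow, neg_one_mul, neg_neg, one_pow, one_smul]
    _ = ((-1 : K) ^ z) • stdCups A x y z := by rw [mul_smul, ← h]

/-- Bookkeeping lemma `trpm_vert` of the binor tensor model of Temperley–Lieb recoupling theory (conventions of KL94 §8.2, §9). [folklore] -/
theorem trpm_vert (x z y : ℕ) : trpm (vert A x z y) = ((-1 : K) ^ z) • dvert A x z y := by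
  rw [vert_def, trpm_comp, trpm_comp, trpm_tens, trpm_jw, trpm_jw, trpm_jw, trpm_stdCups, smul_comp,
    comp_smul, dvert_def, comp_assoc]

/-- Bookkeeping lemma `trpm_dvert` of the binor tensor model of Temperley–Lieb recoupling theory (conventions of KL94 §8.2, §9). [folklore] -/
theorem trpm_dvert (x z y : ℕ) : trpm (dvert A x z y) = ((-1 : K) ^ z) • vert A x z y := by
  rw [dvert_def, trpm_comp, trpm_comp, trpm_tens, trpm_jw, trpm_jw, trpm_jw, trpm_stdCaps, smul_comp,
    comp_smul, vert_def, comp_assoc]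

/-- `(dual vertex) ∘ (vertex) = f_c ∘ core`. [folklore] -/
theorem dvert_comp_vert_eq (hA : A ≠ 0) (x z y : ℕ) (hga : Good A (x + z)) (hgb : Good A (y + z)) :
    dvert A x z y ⊚ vert A x z y = jw A (x + y) ⊚ thetaCore A x z y := by
  rw [dvert_def, vert_def, thetaCore]
  have hjj : (jw A (x + z) ⊗ₘ jw A (y + z)) ⊚ (jw A (x + z) ⊗ₘ jw A (y + z)) =
      jw A (x + z) ⊗ₘ jw A (y + z) := by
    rw [tens_comp_tens, jw_idem' hA hga, jw_idem' hA hgb]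
  simp only [comp_assoc]
  rw [← comp_assoc _ (jw A (x + z) ⊗ₘ jw A (y + z)) (jw A (x + z) ⊗ₘ jw A (y + z)), hjj]

/-- Bookkeeping lemma `thetaCore_comp_jw` of the binor tensor model of Temperley–Lieb recoupling theory (conventions of KL94 §8.2, §9). [folklore] -/
theorem thetaCore_comp_jw (hA : A ≠ 0) (x z y : ℕ) (hgc : Good A (x + y)) :
    thetaCore A x z y ⊚ jw A (x + y) = thetaCore A x z y := by
  rw [thetaCore, ← comp_assoc _ (jw A (x + y)) (jw A (x + y)), jw_idem' hA hgc]

/-- `θ = tr(core)`. [folklore] -/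
theorem theta_eq_trAll_thetaCore (hA : A ≠ 0) (x z y : ℕ) (hga : Good A (x + z)) (hgb : Good A (y + z))
    (hgc : Good A (x + y)) : theta A x z y = trAll A (thetaCore A x z y) := by
  rw [theta, dvert_comp_vert_eq hA x z y hga hgb, trAll_comp_comm hA (IsTL.jw _),
    thetaCore_comp_jw hA x z y hgc]

/-- **The bubble** (KL Lemma 7, diagonal part): `(dual vertex) ∘ (vertex) = (θ/Δ_c) f_c`.
[cite: KauffmanLins1994, §5.1 Lemma 7, §9.10] -/
theorem dvert_comp_vert (hA : A ≠ 0) (x z y : ℕ) (hga : Good A (x + z)) (hgb : Good A (y + z))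
    (hgc : Good A (x + y + 1)) :
    dvert A x z y ⊚ vert A x z y = (theta A x z y / Delta A (x + y)) • jw A (x + y) := by
  have hgc' : Good A (x + y) := hgc.mono (Nat.le_succ _)
  obtain ⟨κ, hκ⟩ := comp_jw_eq_smul hA ((IsTL.jw (x + y)).comp _ (IsTL.thetaCore x z y)) hgc'
  have h1 : dvert A x z y ⊚ vert A x z y = κ • jw A (x + y) := by
    rw [← hκ, dvert_comp_vert_eq hA x z y hga hgb, ← comp_assoc, thetaCore_comp_jw hA x z y hgc']
  have h2 : theta A x z y = κ * Delta A (x + y) := by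
    rw [theta, h1, trAll_smul, trAll_jw hA _ hgc']
  rw [h1, h2, mul_div_cancel_right₀ _ (hgc _ (Nat.lt_succ_self _))]

/-- **The bubble**, off-diagonal part: `(dual vertex)_{c'} ∘ (vertex)_c = 0` for `c' ≠ c`.
[cite: KauffmanLins1994, §5.1 Lemma 7] -/
theorem dvert_comp_vert_eq_zero (hA : A ≠ 0) {x z y x' z' y' : ℕ} (ha : x' + z' = x + z)
    (hb : y' + z' = y + z) (hc : x' + y' ≠ x + y) (hgc : Good A (x + y)) (hgc' : Good A (x' + y')) :
    (dvert A x' z' y').cast (by rw [ha, hb]) rfl ⊚ vert A x z y = 0 := by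
  have e : (dvert A x' z' y').cast (by rw [ha, hb]) rfl ⊚ vert A x z y =
      jw A (x' + y') ⊚ ((stdCaps A x' y' z').cast (by rw [ha, hb]) rfl ⊚
        ((jw A (x' + z') ⊗ₘ jw A (y' + z')).cast (by rw [ha, hb]) (by rw [ha, hb]) ⊚
        (jw A (x + z) ⊗ₘ jw A (y + z))) ⊚ stdCups A x y z) ⊚ jw A (x + y) := by
    apply ext'
    simp only [comp_val, cast_val, dvert_def, vert_def, compR_assoc, ha, hb]
  rw [e]
  exact jw_comp_comp_jw_eq_zero hA ((((IsTL.stdCaps x' y' z').cast _ _).comp _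
    ((((IsTL.jw _).tens (IsTL.jw _)).cast _ _).comp _ ((IsTL.jw _).tens (IsTL.jw _)))).comp _
    (IsTL.stdCups x y z)) (Ne.symm hc) hgc hgc'

end Mor


/-! ### Naturality of positional cups and caps; closing a strand between two boxes -/

namespace Mor

variable (A : K)

/-- A cup to the right of a box slides past it. [folklore] -/
theorem tens_idm_comp_cupAt (X : Mor K n n') (k : ℕ) :
    (X ⊗ₘ idm (k + 2) :) ⊚ cupAt A (n + k) n = cupAt A (n' + k) n' ⊚ (X ⊗ₘ idm k :) := by
  have hWr : RespR (2 + k) (tensR 2 0 (cupR A) (idR k)) := (RespR.cupR A).tensR (RespR.idR k) 0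
  have hWc : RespC k (tensR 2 0 (cupR A) (idR k)) := by simpa using (RespC.cupR A 0).tensR (RespC.idR k) 2
  apply ext'
  simp only [comp_val, tens_val, idm_val]
  rw [cupAt_val A (Nat.le_add_right n k), cupAt_val A (Nat.le_add_right n' k), Nat.add_sub_cancel_left,
    Nat.add_sub_cancel_left, block_eq, block_eq (i := n'), block_zero_left]
  show compR (n + (k + 2)) (tensR n' n X.val (idR (k + 2))) (tensR n n (idR n) (tensR 2 0 (cupR A) (idR k))) =
    compR (n' + k) (tensR n' n' (idR n') (tensR 2 0 (cupR A) (idR k))) (tensR n' n X.val (idR k))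
  rw [show n + (k + 2) = n + (2 + k) by omega, compR_tensR_tensR X.respC (RespR.idR n), compR_idR X.respC,
    Nat.add_comm k 2, idR_compR hWr, compR_tensR_tensR (RespC.idR n') X.respR, idR_compR X.respR, compR_idR hWc]

/-- A cap to the right of a box slides past it. [folklore] -/
theorem capAt_comp_tens_idm (X : Mor K n n') (k : ℕ) :
    capAt A (n' + k) n' ⊚ (X ⊗ₘ idm (k + 2) :) = (X ⊗ₘ idm k :) ⊚ capAt A (n + k) n := by
  have h := congrArg trpm (tens_idm_comp_cupAt A (trpm X) k)
  rw [trpm_comp, trpm_comp, trpm_tens, trpm_tens, trpm_trpm, trpm_idm, trpm_idm, trpm_cupAt, trpm_cupAt,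
    comp_neg, neg_comp, neg_inj] at h
  exact h

/-- A cup to the left of a box slides past it. [folklore] -/
theorem idm_tens_comp_cupAt (i : ℕ) (Y : Mor K m m') :
    (idm (i + 2) ⊗ₘ Y :).cast (by omega) (by omega) ⊚ cupAt A (i + m) i =
      cupAt A (i + m') i ⊚ (idm i ⊗ₘ Y :) := by
  apply ext'
  simp only [comp_val, cast_val, tens_val, idm_val]
  rw [cupAt_val A (Nat.le_add_right i m), cupAt_val A (Nat.le_add_right i m'), Nat.add_sub_cancel_left,
    Nat.add_sub_cancel_left, block_eq, block_eq (j := m'), block_zero_left, block_zero_left, ← tensR_idR_idR i 2,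
    ← tensR_assoc]
  show compR (i + m + 2) (tensR i i (idR i) (tensR 2 2 (idR 2) Y.val)) (tensR i i (idR i) (tensR 2 0 (cupR A) (idR m))) =
    compR (i + m') (tensR i i (idR i) (tensR 2 0 (cupR A) (idR m'))) (tensR i i (idR i) Y.val)
  rw [show i + m + 2 = i + (2 + m) by omega, compR_tensR_tensR (RespC.idR i) (RespR.idR i), idR_compR (RespR.idR i),
    compR_tensR_tensR (RespC.idR 2) (RespR.cupR A), idR_compR (RespR.cupR A), compR_idR Y.respC,
    compR_tensR_tensR (RespC.idR i) (RespR.idR i), idR_compR (RespR.idR i),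
    show (compR m' : Raw K → Raw K → Raw K) = compR (0 + m') by rw [Nat.zero_add],
    ← tensR_zero_zero_idR_zero Y.val, compR_tensR_tensR (RespC.cupR A 0) (RespR.idR 0), compR_idR (RespC.cupR A 0),
    idR_compR Y.respR, tensR_zero_zero_idR_zero]

/-- A cap to the left of a box slides past it. [folklore] -/
theorem capAt_comp_idm_tens (i : ℕ) (Y : Mor K m m') :
    capAt A (i + m') i ⊚ (idm (i + 2) ⊗ₘ Y :).cast (by omega) (by omega) =
      (idm i ⊗ₘ Y :) ⊚ capAt A (i + m) i := by
  have h := congrArg trpm (idm_tens_comp_cupAt A i (trpm Y))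
  rw [trpm_comp, trpm_comp, trpm_cast, trpm_tens, trpm_tens, trpm_trpm, trpm_idm, trpm_idm, trpm_cupAt,
    trpm_cupAt, comp_neg, neg_comp, neg_inj] at h
  exact h

/-- Closing the strand between two boxes on the right box: `∩_a ((X ⊗ 𝟙) ⊗ Y) ∪_a = X ⊗ lptr Y`. [folklore] -/
theorem capAt_tens_tens_cupAt_eq_lptr {a b : ℕ} (X : Mor K a a) (Y : Mor K (b + 1) (b + 1)) :
    capAt A (a + b) a ⊚ ((X ⊗ₘ idm 1 :) ⊗ₘ Y :).cast (by omega) (by omega) ⊚ cupAt A (a + b) a =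
      X ⊗ₘ lptr A Y := by
  apply ext'
  simp only [comp_val, cast_val, tens_val, idm_val, lptr_val]
  rw [capAt_val A (Nat.le_add_right a b), cupAt_val A (Nat.le_add_right a b), Nat.add_sub_cancel_left,
    block_eq, block_eq (a := 2), block_zero_left, block_zero_left, ← tensR_assoc]
  show compR (a + b + 2) (compR (a + b + 2) (tensR a a (idR a) (tensR 0 2 (capR A) (idR b)))
      (tensR a a X.val (tensR 1 1 (idR 1) Y.val))) (tensR a a (idR a) (tensR 2 0 (cupR A) (idR b))) =
    tensR a a X.val (compR (2 + b) (compR (2 + b) (tensR 0 2 (capR A) (idR b)) (tensR 1 1 (idR 1) Y.val))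
      (tensR 2 0 (cupR A) (idR b)))
  rw [show a + b + 2 = a + (2 + b) by omega, compR_tensR_tensR (RespC.idR a) X.respR, idR_compR X.respR,
    compR_tensR_tensR X.respC (RespR.idR a), compR_idR X.respC]

end Mor


/-! ### Straightening the Wenzl turn-back between two boxes -/

namespace Mor

variable (A : K)

/-- Bookkeeping lemma `trp_val_cupAt` of the binor tensor model of Temperley–Lieb recoupling theory (conventions of KL94 §8.2, §9). [folklore] -/
theorem trp_val_cupAt (n i : ℕ) : trp (cupAt A n i).val = -(capAt A n i).val := by
  rw [← trpm_val, trpm_cupAt]; rfl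

/-- Bookkeeping lemma `trp_val_capAt` of the binor tensor model of Temperley–Lieb recoupling theory (conventions of KL94 §8.2, §9). [folklore] -/
theorem trp_val_capAt (n i : ℕ) : trp (capAt A n i).val = -(cupAt A n i).val := by
  rw [← trpm_val, trpm_capAt]; rfl

/-- Bookkeeping lemma `neg_compR'` of the binor tensor model of Temperley–Lieb recoupling theory (conventions of KL94 §8.2, §9). [folklore] -/
theorem neg_compR' (X Y : Raw K) : compR n (-X) Y = -compR n X Y := by
  rw [← neg_one_smul K X, smul_compR, neg_one_smul]

/-- Bookkeeping lemma `compR_neg'` of the binor tensor model of Temperley–Lieb recoupling theory (conventions of KL94 §8.2, §9). [folklore] -/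
theorem compR_neg' (X Y : Raw K) : compR n X (-Y) = -compR n X Y := by
  rw [← neg_one_smul K Y, compR_smul, neg_one_smul]

/-- Bookkeeping lemma `tensR_neg'` of the binor tensor model of Temperley–Lieb recoupling theory (conventions of KL94 §8.2, §9). [folklore] -/
theorem tensR_neg' (X Y : Raw K) : tensR n m X (-Y) = -tensR n m X Y := by
  rw [← neg_one_smul K Y, tensR_smul, neg_one_smul]

/-- Bookkeeping lemma `neg_tensR'` of the binor tensor model of Temperley–Lieb recoupling theory (conventions of KL94 §8.2, §9). [folklore] -/
theorem neg_tensR' (X Y : Raw K) : tensR n m (-X) Y = -tensR n m X Y := by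
  rw [← neg_one_smul K X, smul_tensR, neg_one_smul]

variable {A}

/-- Lower half of the hook straightening (raw): `((𝟙 ⊗ ∩)(J ⊗ 𝟙) ⊗ 𝟙_{b+1}) ∪_{a'+1} = J ⊗ 𝟙_b`. [folklore] -/
theorem hook_low_raw (hA : A ≠ 0) (a' b : ℕ) (J : Raw K) (hJr : RespR (a' + 1) J) (hJc : RespC (a' + 1) J) :
    compR (a' + 1 + 1 + (b + 1)) (tensR (a' + 0) (a' + 2) (tensR a' a' (idR a') (capR A)) (idR (b + 1)))
      (compR (a' + 1 + b + 2) (tensR (a' + 1 + 1) (a' + 1 + 1) (tensR (a' + 1) (a' + 1) J (idR 1)) (idR (b + 1)))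
        (cupAt A (a' + 1 + b) (a' + 1)).val) =
    tensR (a' + 1) (a' + 1) J (idR b) := by
  have hWr : RespR (2 + b) (tensR 2 0 (cupR A) (idR b)) := (RespR.cupR A).tensR (RespR.idR b) 0
  have hWc : RespC b (tensR 2 0 (cupR A) (idR b)) := by simpa using (RespC.cupR A 0).tensR (RespC.idR b) 2
  have h0 := congrArg Mor.val (capAt_cupAt_succ A hA (n := a' + 1 + b) (i := a') (by omega))
  rw [comp_val, idm_val, capAt_val A (by omega), cupAt_val A (by omega), show a' + 1 + b - a' = b + 1 by omega,
    Nat.add_sub_cancel_left, block_eq (i := a' + 1), block_zero_left] at h0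
  unfold block at h0
  have hJW : compR (a' + 1 + b) (tensR (a' + 1) (a' + 1) (idR (a' + 1)) (tensR 2 0 (cupR A) (idR b)))
      (tensR (a' + 1) (a' + 1) J (idR b)) = tensR (a' + 1) (a' + 1) J (tensR 2 0 (cupR A) (idR b)) := by
    rw [compR_tensR_tensR (RespC.idR _) hJr, idR_compR hJr, compR_idR hWc]
  rw [← tensR_assoc (n := a' + 1) (m := a' + 1) (n' := 1) (m' := 1) (X := J), tensR_idR_idR,
    cupAt_val A (by omega), Nat.add_sub_cancel_left, block_eq, block_zero_left,
    show a' + 1 + b + 2 = a' + 1 + (2 + b) by omega, show 1 + (b + 1) = 2 + b by omega,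
    compR_tensR_tensR hJc (RespR.idR (a' + 1)), compR_idR hJc, idR_compR hWr, ← hJW, compR_assoc,
    show a' + 1 + 1 + (b + 1) = a' + 1 + b + 2 by omega, h0, idR_compR (hJr.tensR (RespR.idR b) (a' + 1))]

/-- Upper half of the hook straightening (raw): `∩_{a'+1} ((J ⊗ 𝟙) ⊗ 𝟙_{b+1}) ((𝟙 ⊗ ∪) ⊗ 𝟙_{b+1}) = J ⊗ 𝟙_b`. [folklore] -/
theorem hook_up_raw (hA : A ≠ 0) (a' b : ℕ) (J : Raw K) (hJr : RespR (a' + 1) J) (hJc : RespC (a' + 1) J) :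
    compR (a' + 2 + (b + 1)) (compR (a' + 1 + b + 2) (capAt A (a' + 1 + b) (a' + 1)).val
      (tensR (a' + 1 + 1) (a' + 1 + 1) (tensR (a' + 1) (a' + 1) J (idR 1)) (idR (b + 1))))
      (tensR (a' + 2) (a' + 0) (tensR a' a' (idR a') (cupR A)) (idR (b + 1))) =
    tensR (a' + 1) (a' + 1) J (idR b) := by
  have h := congrArg trp (hook_low_raw hA a' b (trp J) hJc.trp hJr.trp)
  rw [trp_compR, trp_compR, trp_tensR, trp_tensR, trp_tensR, trp_tensR, trp_tensR, trp_idR, trp_idR, trp_idR,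
    trp_idR, trp_trp, trp_capR, trp_val_cupAt, tensR_neg', neg_tensR', neg_compR', compR_neg', neg_compR',
    neg_neg] at h
  exact h

/-- The turn-back term of the Wenzl recursion, squeezed between a cap and a cup at the junction of two
boxes, straightens out: `∩_a ((P U P) ⊗ f_{b+1}) ∪_a = (f_a ⊗ 𝟙)(𝟙 ⊗ f_{b+1})(f_a ⊗ 𝟙)`, `P = f_a ⊗ 𝟙`,
`a = a' + 1`. [cite: MasbaumVogel1994, proof of Thm 1] -/
theorem capAt_hook_cupAt (hA : A ≠ 0) (a' b : ℕ) :
    capAt A (a' + 1 + b) (a' + 1) ⊚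
      ((((jw A (a' + 1) ⊗ₘ idm 1 :) ⊚ (idm a' ⊗ₘ U A :) ⊚ (jw A (a' + 1) ⊗ₘ idm 1 :)) ⊗ₘ jw A (b + 1) :).cast
        (by omega) (by omega)) ⊚ cupAt A (a' + 1 + b) (a' + 1) =
    (jw A (a' + 1) ⊗ₘ idm b :) ⊚ (idm a' ⊗ₘ jw A (b + 1) :).cast (by omega) (by omega) ⊚
      (jw A (a' + 1) ⊗ₘ idm b :) := by
  have hsplit : ((jw A (a' + 1) ⊗ₘ idm 1 :) ⊗ₘ idm (b + 1) :) ⊚ ((idm a' ⊗ₘ cup A :) ⊗ₘ idm (b + 1) :) ⊚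
      (idm (a' + 0) ⊗ₘ jw A (b + 1) :) ⊚ ((idm a' ⊗ₘ cap A :) ⊗ₘ idm (b + 1) :) ⊚
      ((jw A (a' + 1) ⊗ₘ idm 1 :) ⊗ₘ idm (b + 1) :) =
      (((jw A (a' + 1) ⊗ₘ idm 1 :) ⊚ (idm a' ⊗ₘ U A :) ⊚ (jw A (a' + 1) ⊗ₘ idm 1 :)) ⊗ₘ jw A (b + 1) :) := by
    rw [tens_idm_comp_tens_idm, tens_idm_comp_idm_tens, tens_comp_tens, comp_idm, tens_comp_tens, comp_idm,
      idm_tens_U]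
    simp only [comp_assoc]
  rw [← hsplit]
  apply ext'
  simp only [comp_val, cast_val, tens_val, idm_val, cup_val, cap_val, compR_assoc]
  rw [hook_up_raw hA a' b _ (jw A (a' + 1)).respR (jw A (a' + 1)).respC, ← compR_assoc, ← compR_assoc,
    hook_low_raw hA a' b _ (jw A (a' + 1)).respR (jw A (a' + 1)).respC]
  simp only [Nat.add_zero]
  rw [show a' + (b + 1) = a' + 1 + b by omega]

end Mor


namespace Mor

variable {A : K}

/-- Bookkeeping lemma `U_val'` of the binor tensor model of Temperley–Lieb recoupling theory (conventions of KL94 §8.2, §9). [folklore] -/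
theorem U_val' (A : K) : (U A).val = compR 0 (cupR A) (capR A) := rfl

/-- Opening the hook (raw): `(𝟙_{p+1} ⊗ F) ((P U P) ⊗ 𝟙_{b+1}) ∪_{p+1} = (J ⊗ F) ∪_p (J ⊗ 𝟙_b)`,
`P = J ⊗ 𝟙` (`J` a box on `p + 1` strands, `F` a box on `b + 2` strands). [folklore] -/
theorem hook_open_raw (hA : A ≠ 0) (p b : ℕ) (J F : Raw K) (hJr : RespR (p + 1) J) (hJc : RespC (p + 1) J)
    (hFc : RespC (b + 2) F) :
    compR (p + 2 + (b + 1)) (tensR (p + 1) (p + 1) (idR (p + 1)) F)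
      (compR (p + 1 + b + 2) (tensR (p + 2) (p + 2)
        (compR (p + 2) (compR (p + 2) (tensR (p + 1) (p + 1) J (idR 1)) (tensR p p (idR p) (U A).val))
          (tensR (p + 1) (p + 1) J (idR 1))) (idR (b + 1))) (cupAt A (p + 1 + b) (p + 1)).val) =
    compR (p + 2 + (b + 1)) (tensR (p + 1) (p + 1) J F)
      (compR (p + 0 + (b + 1)) (cupAt A (p + (b + 1)) p).val (tensR (p + 1) (p + 1) J (idR b))) := by
  have hPc : RespC (p + 2) (tensR (p + 1) (p + 1) J (idR 1)) := hJc.tensR (RespC.idR 1) (p + 1)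
  have hPr : RespR (p + 2) (tensR (p + 1) (p + 1) J (idR 1)) := hJr.tensR (RespR.idR 1) (p + 1)
  have hC1r : RespR (p + 2) (tensR p p (idR p) (cupR A)) := (RespR.idR p).tensR (RespR.cupR A) p
  have hC2c : RespC (p + 2) (tensR p p (idR p) (capR A)) := (RespC.idR p).tensR (RespC.capR A) p
  have hQ1c : RespC (p + 0) (compR (p + 2) (tensR (p + 1) (p + 1) J (idR 1)) (tensR p p (idR p) (cupR A))) :=
    RespC.compR _ _ ((RespC.idR p).tensR (RespC.cupR A 0) p)
  have hQ2r : RespR (p + 0) (compR (p + 2) (tensR p p (idR p) (capR A)) (tensR (p + 1) (p + 1) J (idR 1))) :=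
    RespR.compR _ ((RespR.idR p).tensR (RespR.capR A 0) p) _
  rw [U_val', idR_tensR_compR, compR_assoc (tensR (p + 1) (p + 1) J (idR 1)), ← compR_assoc,
    tensR_compR_idR (b + 1) hQ1c hQ2r, ← compR_assoc, tensR_compR_idR (b + 1) hC2c hPr, ← compR_assoc,
    hook_low_raw hA p b J hJr hJc, tensR_compR_idR (b + 1) hPc hC1r, ← compR_assoc, compR_assoc,
    ← tensR_assoc (n := p + 1) (m := p + 1) (n' := 1) (m' := 1) (X := J), tensR_idR_idR,
    show 1 + (b + 1) = b + 2 by omega, show p + 2 + (b + 1) = p + 1 + (b + 2) by omega,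
    compR_tensR_tensR (RespC.idR (p + 1)) hJr, idR_compR hJr, compR_idR hFc, cupAt_val A (Nat.le_add_right p _),
    Nat.add_sub_cancel_left]
  rfl

end Mor


/-! ### Masbaum–Vogel's Lemma 2 (our form): the bent vertex -/

namespace Mor

variable {A : K}

/-- Bookkeeping lemma `cupAt_val_congr` of the binor tensor model of Temperley–Lieb recoupling theory (conventions of KL94 §8.2, §9). [folklore] -/
theorem cupAt_val_congr (A : K) {n n' i i' : ℕ} (hn : n = n') (hi : i = i') :
    (cupAt A n i).val = (cupAt A n' i').val := by subst hn hi; rfl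


/-- Bookkeeping lemma `lam_zero` of the binor tensor model of Temperley–Lieb recoupling theory (conventions of KL94 §8.2, §9). [folklore] -/
theorem lam_zero {x' : ℕ} (hx : Delta A x' ≠ 0) : lam A x' 0 = 1 := by
  rw [lam, pow_zero, one_mul, Nat.add_zero, div_self hx]

/-- Bookkeeping lemma `lam_succ` of the binor tensor model of Temperley–Lieb recoupling theory (conventions of KL94 §8.2, §9). [folklore] -/
theorem lam_succ (x' z : ℕ) (h1 : Delta A (x' + z) ≠ 0) :
    lam A x' (z + 1) = -(Delta A (x' + z) / Delta A (x' + z + 1)) * lam A x' z := by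
  rw [lam, lam, show x' + (z + 1) = x' + z + 1 by omega, pow_succ]
  field_simp

/-- **The bent vertex, base case** (`z = 0`). [folklore] -/
theorem bentVertex_zero (hA : A ≠ 0) (x' y : ℕ) (hgx : Good A (x' + 2)) (hgc : Good A (x' + y + 2)) :
    ((idm (x' + 0) ⊗ₘ jw A (y + 0 + 1) :).cast (show x' + 0 + (y + 0 + 1) = x' + 1 + 0 + (y + 0) by omega)
      (show x' + 0 + (y + 0 + 1) = x' + 1 + 0 + (y + 0) by omega)) ⊚ (jw A (x' + 1 + 0) ⊗ₘ idm (y + 0) :) ⊚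
        stdCups A (x' + 1) y 0 ⊚ jw A (x' + 1 + y) =
      (lam A x' 0) • (vert A x' 0 (y + 1)).cast (show x' + (y + 1) = x' + 1 + y by omega)
        (show x' + 0 + (y + 1 + 0) = x' + 1 + 0 + (y + 0) by omega) := by
  rw [lam_zero (hgx x' (by omega)), one_smul]
  have h1 := congrArg Mor.val (jw_absorb_left' hA (k := x' + 1) y (hgc.mono (by omega)))
  have h2 := congrArg Mor.val (idm_tens_jw_comp_jw hA x' (y + 1) (hgc.mono (by omega)))
  have h3 : (jw A x' ⊗ₘ jw A (y + 1)) ⊚ jw A (x' + (y + 1)) = jw A (x' + (y + 1)) := by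
    rw [tens_eq_comp_left, ← comp_assoc, idm_tens_jw_comp_jw hA x' (y + 1) (hgc.mono (by omega)),
      jw_absorb_left' hA (k := x') (y + 1) (hgc.mono (by omega))]
  have h3' := congrArg Mor.val h3
  simp only [comp_val, tens_val, idm_val] at h1 h2 h3'
  rw [jw_val_congr (show x' + (y + 1) = x' + 1 + y by omega), show x' + (y + 1) = x' + 1 + y by omega] at h2 h3'
  apply ext'
  simp only [comp_val, cast_val, tens_val, idm_val, stdCups_zero, vert_def, Nat.add_zero]
  rw [compR_idR (((jw A (x' + 1)).respC.tensR (RespC.idR y) (x' + 1)).compR _ _), ← compR_assoc, h1, h2,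
    compR_idR ((jw A x').respC.tensR (jw A (y + 1)).respC x'), show x' + (y + 1) = x' + 1 + y by omega, h3']

end Mor


namespace Mor

variable {A : K}

/-- **The bent vertex** (Masbaum–Vogel's Lemma 2 in our layout): feeding the last strand of `f_{x'+1+z}`
into the right projector `f_{y+z+1}` above the vertex cups gives `λ(x', z)` times the 3-vertex with
internal lines `(x', z, y+1)`. [cite: MasbaumVogel1994, Lemma 2] -/
theorem bentVertex (hA : A ≠ 0) (x' y : ℕ) : ∀ z : ℕ, Good A (x' + z + 2) → Good A (y + z + 2) →
    Good A (x' + y + 2) →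
    ((idm (x' + z) ⊗ₘ jw A (y + z + 1) :).cast (show x' + z + (y + z + 1) = x' + 1 + z + (y + z) by omega)
      (show x' + z + (y + z + 1) = x' + 1 + z + (y + z) by omega)) ⊚ (jw A (x' + 1 + z) ⊗ₘ idm (y + z) :) ⊚
        stdCups A (x' + 1) y z ⊚ jw A (x' + 1 + y) =
      (lam A x' z) • (vert A x' z (y + 1)).cast (show x' + (y + 1) = x' + 1 + y by omega)
        (show x' + z + (y + 1 + z) = x' + 1 + z + (y + z) by omega)
  | 0 => fun hgx _ hgc => bentVertex_zero hA x' y hgx hgc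
  | z + 1 => by
    intro hgx hgy hgc
    have IH := congrArg Mor.val (bentVertex hA x' y z (hgx.mono (by omega)) (hgy.mono (by omega)) hgc)
    -- the vanishing term
    have hT1 : ((idm (x' + z + 1) ⊗ₘ jw A (y + z + 2) :) ⊚ (jw A (x' + z + 1) ⊗ₘ idm (y + z + 2) :) ⊚
        (cupAt A (x' + z + 1 + (y + z)) (x' + z + 1 + 0)).cast rfl (by omega)).val = 0 := by
      rw [idm_tens_comp_tens_idm]
      exact congrArg Mor.val (jw_tens_jw_comp_cupAt_right hA (a := x' + z + 1) (b := y + z) (i := 0)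
        (Nat.zero_le _) (hgy.mono (by omega)) (by omega))
    -- opening the hook
    have hopen := hook_open_raw hA (x' + z) (y + z) (jw A (x' + z + 1)).val (jw A (y + z + 2)).val
      (jw A (x' + z + 1)).respR (jw A (x' + z + 1)).respC (jw A (y + z + 2)).respC
    -- inserting the smaller projectors under the straddling cup
    have hstr := congrArg Mor.val (jw_tens_jw_comp_cupAt_straddle hA (x' + z) (y + z + 1) (hgx.mono (by omega))
      (hgy.mono (by omega)))
    -- absorbing `f_{x'+z} ⊗ 𝟙` into `f_{x'+z+1} ⊗ 𝟙`
    have habs : ((jw A (x' + z) ⊗ₘ idm 1 :) ⊗ₘ idm (y + z) :) ⊚ (jw A (x' + z + 1) ⊗ₘ idm (y + z) :) =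
        (jw A (x' + z + 1) ⊗ₘ idm (y + z) :) := by
      rw [tens_idm_comp_tens_idm, jw_absorb_left hA (hgx.mono (by omega))]
    have habs' := congrArg Mor.val habs
    simp only [comp_val, cast_val, tens_val, idm_val, Nat.add_zero] at hT1 hstr habs'
    simp only [comp_val, cast_val, tens_val, idm_val, smul_val, vert_def] at IH
    rw [Nat.add_zero] at hopen
    apply ext'
    simp only [comp_val, cast_val, tens_val, idm_val, smul_val, stdCups_succ, vert_def]
    -- normalise all strand counts
    simp only [show x' + 1 + (z + 1) = x' + z + 2 by omega, show x' + (z + 1) = x' + z + 1 by omega,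
      show y + (z + 1) = y + z + 1 by omega, show x' + 1 + z = x' + z + 1 by omega,
      show x' + (y + 1) = x' + 1 + y by omega, show y + 1 + z = y + z + 1 by omega,
      show y + 1 + (z + 1) = y + z + 2 by omega,
      show x' + z + (y + z + 1) = x' + z + 1 + (y + z) by omega,
      show x' + z + 1 + (y + z + 2) = x' + z + 2 + (y + z + 1) by omega] at IH ⊢
    rw [jw_val_congr (show x' + 1 + (z + 1) = x' + z + 2 by omega), jw_val_congr (show y + (z + 1) + 1 = y + z + 2 by omega),
      jw_val_congr (show x' + (z + 1) = x' + z + 1 by omega), jw_val_congr (show y + 1 + (z + 1) = y + z + 2 by omega),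
      jw_val_congr (show x' + (y + 1) = x' + 1 + y by omega),
      cupAt_val_congr A (show x' + 1 + z + (y + z) = x' + z + 1 + (y + z) by omega) (rfl : x' + z + 1 = _),
      cupAt_val_congr A (show x' + z + (y + 1 + z) = x' + z + 1 + (y + z) by omega) (rfl : x' + z = _)]
    rw [jw_val_congr (show x' + 1 + z = x' + z + 1 by omega), jw_val_congr (show y + 1 + z = y + z + 1 by omega),
      jw_val_congr (show x' + (y + 1) = x' + 1 + y by omega)] at IH
    simp only [show x' + z + 1 + (y + z + 2) = x' + z + 2 + (y + z + 1) by omega] at hT1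
    simp only [show x' + z + 1 + (y + z) + 2 = x' + z + 2 + (y + z + 1) by omega,
      show x' + z + 0 + (y + z + 1) = x' + z + 1 + (y + z) by omega] at hopen
    rw [cupAt_val_congr A (show x' + z + (y + z + 1) = x' + z + 1 + (y + z) by omega) (rfl : x' + z = _)] at hopen
    simp only [show x' + z + 1 + (y + z + 1 + 1) = x' + z + 2 + (y + z + 1) by omega,
      show x' + z + (y + z + 1) = x' + z + 1 + (y + z) by omega] at hstr
    rw [jw_val_congr (show y + z + 1 + 1 = y + z + 2 by omega),
      cupAt_val_congr A (show x' + z + (y + z + 1) = x' + z + 1 + (y + z) by omega) (rfl : x' + z = _)] at hstr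
    rw [← tensR_assoc (X := (jw A (x' + z)).val) (n := x' + z) (m := x' + z) (n' := 1) (m' := 1), tensR_idR_idR,
      show 1 + (y + z) = y + z + 1 by omega] at habs'
    have hsplit2 : tensR (x' + z) (x' + z) (jw A (x' + z)).val (jw A (y + z + 1)).val =
        compR (x' + z + 1 + (y + z)) (tensR (x' + z) (x' + z) (idR (x' + z)) (jw A (y + z + 1)).val)
          (tensR (x' + z) (x' + z) (jw A (x' + z)).val (idR (y + z + 1))) := by
      rw [show x' + z + 1 + (y + z) = x' + z + (y + z + 1) by omega, compR_tensR_tensR (RespC.idR _) (jw A (x' + z)).respR,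
        idR_compR (jw A (x' + z)).respR, compR_idR (jw A (y + z + 1)).respC]
    -- expand `f_{x'+z+2}` by the Wenzl recursion and split into two terms
    rw [jw_succ_succ A (x' + z)]
    simp only [sub_val, smul_val, comp_val, tens_val, idm_val]
    rw [sub_tensR, smul_tensR, compR_sub, compR_smul, sub_compR, smul_compR, sub_compR, smul_compR]
    -- the first term vanishes
    rw [← tensR_assoc (X := (jw A (x' + z + 1)).val) (n := x' + z + 1) (m := x' + z + 1) (n' := 1) (m' := 1),
      tensR_idR_idR, show 1 + (y + z + 1) = y + z + 2 by omega,
      compR_assoc (compR _ _ (tensR (x' + z + 1) (x' + z + 1) (jw A (x' + z + 1)).val (idR (y + z + 2))))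
        (cupAt A _ _).val (stdCups A (x' + 1) y z).val, hT1, zero_compR, zero_compR, zero_sub]
    -- the second term
    rw [compR_assoc (compR _ (tensR (x' + z + 1) (x' + z + 1) (idR (x' + z + 1)) (jw A (y + z + 2)).val) _)
        (cupAt A _ _).val (stdCups A (x' + 1) y z).val,
      ← compR_assoc (tensR (x' + z + 1) (x' + z + 1) (idR (x' + z + 1)) (jw A (y + z + 2)).val) _ (cupAt A _ _).val,
      hopen,
      compR_assoc (tensR (x' + z + 1) (x' + z + 1) (jw A (x' + z + 1)).val (jw A (y + z + 2)).val) (cupAt A _ _).val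
        (tensR (x' + z + 1) (x' + z + 1) (jw A (x' + z + 1)).val (idR (y + z))),
      hstr, hsplit2,
      ← compR_assoc (compR _ (tensR (x' + z + 1) (x' + z + 1) (jw A (x' + z + 1)).val (jw A (y + z + 2)).val) _) _
        (tensR (x' + z + 1) (x' + z + 1) (jw A (x' + z + 1)).val (idR (y + z))),
      ← compR_assoc (tensR (x' + z) (x' + z) (idR (x' + z)) (jw A (y + z + 1)).val) _
        (tensR (x' + z + 1) (x' + z + 1) (jw A (x' + z + 1)).val (idR (y + z))),
      habs',
      ← compR_assoc (compR _ (tensR (x' + z + 1) (x' + z + 1) (jw A (x' + z + 1)).val (jw A (y + z + 2)).val) _) _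
        (stdCups A (x' + 1) y z).val,
      ← compR_assoc (compR _ (tensR (x' + z + 1) (x' + z + 1) (jw A (x' + z + 1)).val (jw A (y + z + 2)).val) _) _
        (jw A (x' + 1 + y)).val,
      IH, compR_smul,
      compR_assoc (compR _ (tensR (x' + z + 1) (x' + z + 1) (jw A (x' + z + 1)).val (jw A (y + z + 2)).val) _) _
        (jw A (x' + 1 + y)).val,
      compR_assoc (compR _ (tensR (x' + z + 1) (x' + z + 1) (jw A (x' + z + 1)).val (jw A (y + z + 2)).val) _) _
        (stdCups A x' (y + 1) z).val,
      ← hstr,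
      compR_assoc (tensR (x' + z + 1) (x' + z + 1) (jw A (x' + z + 1)).val (jw A (y + z + 2)).val) (cupAt A _ _).val
        (stdCups A x' (y + 1) z).val,
      lam_succ x' z (hgx (x' + z) (by omega)), smul_smul, neg_mul, neg_smul]

end Mor


/-! ### The junction of two projectors closed by a cup and a cap -/

namespace Mor

variable {A : K}

/-- Bookkeeping lemma `cast_sub` of the binor tensor model of Temperley–Lieb recoupling theory (conventions of KL94 §8.2, §9). [folklore] -/
theorem cast_sub (X Y : Mor K m n) (hm : m = m') (hn : n = n') : (X - Y).cast hm hn = X.cast hm hn - Y.cast hm hn := by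
  subst hm hn; rfl

/-- **Junction expansion** (`a = a' + 1`): `∩_a (f_{a+1} ⊗ f_{b+1}) ∪_a =
(Δ_{b+1}/Δ_b) (f_a ⊗ f_b) - (Δ_{a-1}/Δ_a) (f_a ⊗ 𝟙)(𝟙 ⊗ f_{b+1})(f_a ⊗ 𝟙)`: Wenzl's recursion on the last
strand of `f_{a+1}`, Lemma 1 on the first strand of `f_{b+1}`, and the hook straightening.
[cite: MasbaumVogel1994, proof of Thm 1; KauffmanLins1994, §9.8] -/
theorem junction_succ (hA : A ≠ 0) (a' b : ℕ) (hgb : Good A (b + 1)) :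
    capAt A (a' + 1 + b) (a' + 1) ⊚ (jw A (a' + 2) ⊗ₘ jw A (b + 1) :).cast (by omega) (by omega) ⊚
        cupAt A (a' + 1 + b) (a' + 1) =
      (Delta A (b + 1) / Delta A b) • (jw A (a' + 1) ⊗ₘ jw A b :) -
        (Delta A a' / Delta A (a' + 1)) • ((jw A (a' + 1) ⊗ₘ idm b :) ⊚
          (idm a' ⊗ₘ jw A (b + 1) :).cast (by omega) (by omega) ⊚ (jw A (a' + 1) ⊗ₘ idm b :)) := by
  rw [jw_succ_succ A a', sub_tens, smul_tens, cast_sub, cast_smul, comp_sub, comp_smul, sub_comp, smul_comp,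
    capAt_tens_tens_cupAt_eq_lptr, lptr_jw hA hgb, tens_smul, capAt_hook_cupAt hA a' b]

/-- **Junction expansion**, `a = 0`: `∩_0 (f_1 ⊗ f_{b+1}) ∪_0 = (Δ_{b+1}/Δ_b) (f_0 ⊗ f_b)`. [cite: KauffmanLins1994, §9.8] -/
theorem junction_zero (hA : A ≠ 0) (b : ℕ) (hgb : Good A (b + 1)) :
    capAt A (0 + b) 0 ⊚ (jw A 1 ⊗ₘ jw A (b + 1) :).cast (by omega) (by omega) ⊚ cupAt A (0 + b) 0 =
      (Delta A (b + 1) / Delta A b) • (jw A 0 ⊗ₘ jw A b :) := by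
  have e : (jw A 1 : Mor K 1 1) = (idm 0 ⊗ₘ idm 1 : Mor K (0 + 1) (0 + 1)) := by rw [jw_one, idm_tens_idm]
  rw [e, capAt_tens_tens_cupAt_eq_lptr, lptr_jw hA hgb, tens_smul, jw_zero]

end Mor

/-! ### Linearity of the raw trace -/

/-- Bookkeeping lemma `trW_add` of the binor tensor model of Temperley–Lieb recoupling theory (conventions of KL94 §8.2, §9). [folklore] -/
theorem trW_add (A : K) (n : ℕ) (X Y : Raw K) : trW A n (X + Y) = trW A n X + trW A n Y := by
  simp only [trW, Pi.add_apply, mul_add, Finset.sum_add_distrib]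

/-- Bookkeeping lemma `trW_smul` of the binor tensor model of Temperley–Lieb recoupling theory (conventions of KL94 §8.2, §9). [folklore] -/
theorem trW_smul (A : K) (n : ℕ) (c : K) (X : Raw K) : trW A n (c • X) = c * trW A n X := by
  simp only [trW, Pi.smul_apply, smul_eq_mul, Finset.mul_sum]
  exact Finset.sum_congr rfl (fun _ _ => by ring)

/-- Bookkeeping lemma `trW_sub` of the binor tensor model of Temperley–Lieb recoupling theory (conventions of KL94 §8.2, §9). [folklore] -/
theorem trW_sub (A : K) (n : ℕ) (X Y : Raw K) : trW A n (X - Y) = trW A n X - trW A n Y := by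
  simp only [trW, Pi.sub_apply, mul_sub, Finset.sum_sub_distrib]

/-- Bookkeeping lemma `trW_neg` of the binor tensor model of Temperley–Lieb recoupling theory (conventions of KL94 §8.2, §9). [folklore] -/
theorem trW_neg (A : K) (n : ℕ) (X : Raw K) : trW A n (-X) = -trW A n X := by
  simp only [trW, Pi.neg_apply, mul_neg, Finset.sum_neg_distrib]

/-- Bookkeeping lemma `trW_zero'` of the binor tensor model of Temperley–Lieb recoupling theory (conventions of KL94 §8.2, §9). [folklore] -/
@[simp] theorem trW_zero' (A : K) (n : ℕ) : trW A n (0 : Raw K) = 0 := by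
  simp [trW]

/-! ### The θ-net: base case -/

namespace Mor

variable {A : K}

/-- `θ(x, 0, y) = Δ_{x+y}` (no internal lines between the two upper blocks). [cite: MasbaumVogel1994, proof of Thm 1] -/
theorem theta_zero_mid (hA : A ≠ 0) (x y : ℕ) (hg : Good A (x + y + 1)) : theta A x 0 y = Delta A (x + y) := by
  have hg' : Good A (x + y) := hg.mono (Nat.le_succ _)
  have h1 : (jw A x ⊗ₘ jw A y) ⊚ jw A (x + y) = jw A (x + y) := by
    rw [tens_eq_comp_left, ← comp_assoc, idm_tens_jw_comp_jw hA x y hg', jw_absorb_left' hA y hg']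
  have h1' := congrArg Mor.val h1
  rw [comp_val, tens_val] at h1'
  have hcore : thetaCore A x 0 y = jw A (x + y) := by
    apply ext'
    simp only [thetaCore, comp_val, stdCaps_zero, stdCups_zero, tens_val, idm_val, Nat.add_zero]
    rw [idR_compR ((jw A x).respR.tensR (jw A y).respR x), compR_idR ((jw A x).respC.tensR (jw A y).respC x), h1']
  rw [theta_eq_trAll_thetaCore hA x 0 y (hg.mono (by omega)) (hg.mono (by omega)) hg', hcore, trAll_jw hA _ hg']

end Mor

/-! ### The bent vertex and its dual; the second term of the θ recursion -/

namespace Mor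

variable (A : K)


variable {A}

/-- Bookkeeping lemma `bentW_def` of the binor tensor model of Temperley–Lieb recoupling theory (conventions of KL94 §8.2, §9). [folklore] -/
theorem bentW_def (x' y z : ℕ) : bentW A x' y z =
    ((idm (x' + z) ⊗ₘ jw A (y + z + 1) :).cast (show x' + z + (y + z + 1) = x' + 1 + z + (y + z) by omega)
      (show x' + z + (y + z + 1) = x' + 1 + z + (y + z) by omega)) ⊚ (jw A (x' + 1 + z) ⊗ₘ idm (y + z) :) ⊚
        stdCups A (x' + 1) y z ⊚ jw A (x' + 1 + y) := rfl

/-- Bookkeeping lemma `bentWd_def` of the binor tensor model of Temperley–Lieb recoupling theory (conventions of KL94 §8.2, §9). [folklore] -/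
theorem bentWd_def (x' y z : ℕ) : bentWd A x' y z =
    stdCaps A (x' + 1) y z ⊚ (jw A (x' + 1 + z) ⊗ₘ idm (y + z) :) ⊚
      ((idm (x' + z) ⊗ₘ jw A (y + z + 1) :).cast (show x' + z + (y + z + 1) = x' + 1 + z + (y + z) by omega)
        (show x' + z + (y + z + 1) = x' + 1 + z + (y + z) by omega)) := rfl

/-- Bookkeeping lemma `bentW` of the binor tensor model of Temperley–Lieb recoupling theory (conventions of KL94 §8.2, §9). [folklore] -/
theorem _root_.Literature.RepresentationTheory.ModularTensorCategories.TemperleyLieb.IsTL.bentW (x' y z : ℕ) :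
    IsTL A (bentW A x' y z) :=
  ((((((IsTL.idm _).tens (IsTL.jw _)).cast _ _).comp _ ((IsTL.jw _).tens (IsTL.idm _))).comp _
    (IsTL.stdCups _ _ z)).comp _ (IsTL.jw _))

/-- Bookkeeping lemma `bentWd` of the binor tensor model of Temperley–Lieb recoupling theory (conventions of KL94 §8.2, §9). [folklore] -/
theorem _root_.Literature.RepresentationTheory.ModularTensorCategories.TemperleyLieb.IsTL.bentWd (x' y z : ℕ) :
    IsTL A (bentWd A x' y z) :=
  ((IsTL.stdCaps _ _ z).comp _ ((IsTL.jw _).tens (IsTL.idm _))).comp _ (((IsTL.idm _).tens (IsTL.jw _)).cast _ _)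

/-- The bent vertex is `λ` times a vertex (typed restatement of `bentVertex`). [folklore] -/
theorem bentW_eq (hA : A ≠ 0) (x' y z : ℕ) (hgx : Good A (x' + z + 2)) (hgy : Good A (y + z + 2))
    (hgc : Good A (x' + y + 2)) :
    bentW A x' y z = (lam A x' z) • (vert A x' z (y + 1)).cast (show x' + (y + 1) = x' + 1 + y by omega)
      (show x' + z + (y + 1 + z) = x' + 1 + z + (y + z) by omega) :=
  bentVertex hA x' y z hgx hgy hgc

/-- The dual statement: `f_c ∘ W^∨ = λ · (dual vertex)` (transpose of `bentW_eq`). [folklore] -/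
theorem jw_comp_bentWd (hA : A ≠ 0) (x' y z : ℕ) (hgx : Good A (x' + z + 2)) (hgy : Good A (y + z + 2))
    (hgc : Good A (x' + y + 2)) :
    jw A (x' + 1 + y) ⊚ bentWd A x' y z = (lam A x' z) • (dvert A x' z (y + 1)).cast
      (show x' + z + (y + 1 + z) = x' + 1 + z + (y + z) by omega) (show x' + (y + 1) = x' + 1 + y by omega) := by
  have h := congrArg trpm (bentW_eq hA x' y z hgx hgy hgc)
  rw [bentW_def, trpm_comp, trpm_comp, trpm_comp, trpm_jw, trpm_stdCups, trpm_tens, trpm_jw, trpm_idm, trpm_cast,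
    trpm_tens, trpm_idm, trpm_jw, trpm_smul, trpm_cast, trpm_vert, cast_smul, smul_smul, smul_comp, comp_smul] at h
  have h2 : ((-1 : K) ^ z) • (jw A (x' + 1 + y) ⊚ bentWd A x' y z) =
      ((-1 : K) ^ z) • ((lam A x' z) • (dvert A x' z (y + 1)).cast
        (show x' + z + (y + 1 + z) = x' + 1 + z + (y + z) by omega) (show x' + (y + 1) = x' + 1 + y by omega)) := by
    rw [bentWd_def, smul_smul, mul_comm, ← h]
    simp only [comp_assoc]
  have hne : ((-1 : K) ^ z) ≠ 0 := pow_ne_zero z (neg_ne_zero.mpr one_ne_zero)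
  exact smul_right_injective (Mor K _ _) hne h2

/-- `W^∨ ∘ W = caps ∘ (f_a ⊗ 𝟙)(𝟙 ⊗ f_{b+1})(f_a ⊗ 𝟙) ∘ cups ∘ f_c`. [folklore] -/
theorem bentWd_comp_bentW (hA : A ≠ 0) (x' y z : ℕ) (hgy : Good A (y + z + 1)) :
    bentWd A x' y z ⊚ bentW A x' y z =
      stdCaps A (x' + 1) y z ⊚ ((jw A (x' + 1 + z) ⊗ₘ idm (y + z) :) ⊚
        ((idm (x' + z) ⊗ₘ jw A (y + z + 1) :).cast (show x' + z + (y + z + 1) = x' + 1 + z + (y + z) by omega)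
          (show x' + z + (y + z + 1) = x' + 1 + z + (y + z) by omega)) ⊚ (jw A (x' + 1 + z) ⊗ₘ idm (y + z) :)) ⊚
        stdCups A (x' + 1) y z ⊚ jw A (x' + 1 + y) := by
  have hI : ((idm (x' + z) ⊗ₘ jw A (y + z + 1) :).cast (show x' + z + (y + z + 1) = x' + 1 + z + (y + z) by omega)
      (show x' + z + (y + z + 1) = x' + 1 + z + (y + z) by omega)) ⊚
      ((idm (x' + z) ⊗ₘ jw A (y + z + 1) :).cast (show x' + z + (y + z + 1) = x' + 1 + z + (y + z) by omega)
        (show x' + z + (y + z + 1) = x' + 1 + z + (y + z) by omega)) =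
      ((idm (x' + z) ⊗ₘ jw A (y + z + 1) :).cast (show x' + z + (y + z + 1) = x' + 1 + z + (y + z) by omega)
        (show x' + z + (y + z + 1) = x' + 1 + z + (y + z) by omega)) := by
    rw [cast_comp_cast, idm_tens_comp_idm_tens, jw_idem' hA hgy]
  rw [bentWd_def, bentW_def]
  simp only [comp_assoc]
  rw [← comp_assoc (stdCaps A (x' + 1) y z ⊚ (jw A (x' + 1 + z) ⊗ₘ idm (y + z) :)), hI]

/-- `tr(W^∨ W) = λ² θ(x', z, y+1)`. [folklore] -/
theorem trAll_bentWd_bentW (hA : A ≠ 0) (x' y z : ℕ) (hgx : Good A (x' + z + 2)) (hgy : Good A (y + z + 2))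
    (hgc : Good A (x' + y + 2)) :
    trAll A (bentWd A x' y z ⊚ bentW A x' y z) = lam A x' z ^ 2 * theta A x' z (y + 1) := by
  have hW : bentW A x' y z ⊚ jw A (x' + 1 + y) = bentW A x' y z := by
    rw [bentW_def, ← comp_assoc _ (jw A (x' + 1 + y)) (jw A (x' + 1 + y)), jw_idem' hA (hgc.mono (by omega))]
  rw [← hW, comp_assoc, trAll_comp_comm hA ((IsTL.bentWd x' y z).comp _ (IsTL.bentW x' y z)), comp_assoc,
    jw_comp_bentWd hA x' y z hgx hgy hgc, bentW_eq hA x' y z hgx hgy hgc, smul_comp, comp_smul, smul_smul,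
    trAll_smul, cast_comp_cast, trAll_cast, theta, sq]

end Mor


/-! ### The θ recursion -/

namespace Mor

variable {A : K}

/-- Bookkeeping lemma `capAt_val_congr` of the binor tensor model of Temperley–Lieb recoupling theory (conventions of KL94 §8.2, §9). [folklore] -/
theorem capAt_val_congr (A : K) {n n' i i' : ℕ} (hn : n = n') (hi : i = i') :
    (capAt A n i).val = (capAt A n' i').val := by subst hn hi; rfl

/-- One more internal line: the core of `θ(x'+1, z+1, y)` expanded at the junction (raw). [folklore] -/
theorem thetaCore_succ_val (hA : A ≠ 0) (x' y z : ℕ) (hgy : Good A (y + z + 2)) :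
    (thetaCore A (x' + 1) (z + 1) y).val =
      (Delta A (y + z + 1) / Delta A (y + z)) • (thetaCore A (x' + 1) z y).val -
        (Delta A (x' + z) / Delta A (x' + z + 1)) • (bentWd A x' y z ⊚ bentW A x' y z).val := by
  have hj := congrArg Mor.val (junction_succ hA (x' + z) (y + z) (hgy.mono (by omega)))
  rw [bentWd_comp_bentW hA x' y z (hgy.mono (by omega))]
  simp only [comp_val, cast_val, tens_val, idm_val, sub_val, smul_val] at hj
  simp only [thetaCore, comp_val, cast_val, tens_val, idm_val, stdCaps_succ, stdCups_succ]
  simp only [show x' + 1 + (z + 1) = x' + z + 2 by omega, show y + (z + 1) = y + z + 1 by omega,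
    show x' + 1 + z = x' + z + 1 by omega] at hj ⊢
  simp only [show x' + z + 1 + (y + z) + 2 = x' + z + 2 + (y + z + 1) by omega] at hj
  rw [jw_val_congr (show x' + 1 + (z + 1) = x' + z + 2 by omega), jw_val_congr (show y + (z + 1) = y + z + 1 by omega),
    jw_val_congr (show x' + 1 + z = x' + z + 1 by omega),
    capAt_val_congr A (show x' + 1 + z + (y + z) = x' + z + 1 + (y + z) by omega) (rfl : x' + z + 1 = _),
    cupAt_val_congr A (show x' + 1 + z + (y + z) = x' + z + 1 + (y + z) by omega) (rfl : x' + z + 1 = _),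
    ← compR_assoc (stdCaps A (x' + 1) y z).val (capAt A _ _).val _,
    ← compR_assoc (stdCaps A (x' + 1) y z).val _ (compR _ (cupAt A _ _).val _),
    compR_assoc (compR _ (capAt A _ _).val _) (cupAt A _ _).val (stdCups A (x' + 1) y z).val, hj,
    sub_compR, smul_compR, smul_compR, compR_sub, compR_smul, compR_smul, sub_compR, smul_compR, smul_compR]
  simp only [compR_assoc]

end Mor


namespace Mor

variable {A : K}

/-- **The θ recursion** (Masbaum–Vogel, proof of Thm 1), generic internal lines:
`θ(x'+1, z+1, y) = (Δ_{b+1}/Δ_b) θ(x'+1, z, y) - (Δ_{a-1}/Δ_a) λ(x',z)² θ(x', z, y+1)`, `a = x'+1+z`, `b = y+z`.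
[cite: MasbaumVogel1994, Thm 1 (proof)] -/
theorem theta_succ_succ (hA : A ≠ 0) (x' y z : ℕ) (hgx : Good A (x' + z + 2)) (hgy : Good A (y + z + 2))
    (hgc : Good A (x' + y + 2)) :
    theta A (x' + 1) (z + 1) y = (Delta A (y + z + 1) / Delta A (y + z)) * theta A (x' + 1) z y -
      (Delta A (x' + z) / Delta A (x' + z + 1)) * (lam A x' z ^ 2 * theta A x' z (y + 1)) := by
  rw [theta_eq_trAll_thetaCore hA (x' + 1) (z + 1) y (hgx.mono (by omega)) (hgy.mono (by omega)) (hgc.mono (by omega)),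
    trAll_eq_trW, thetaCore_succ_val hA x' y z hgy, trW_sub, trW_smul, trW_smul, ← trAll_eq_trW, ← trAll_eq_trW,
    ← theta_eq_trAll_thetaCore hA (x' + 1) z y (hgx.mono (by omega)) (hgy.mono (by omega)) (hgc.mono (by omega)),
    trAll_bentWd_bentW hA x' y z hgx hgy hgc]

/-- `θ(0, 1, y)` core: `(core of θ(0,1,y)) = (Δ_{y+1}/Δ_y) · (core of θ(0,0,y))` (raw). [folklore] -/
theorem thetaCore_zero_one_val (hA : A ≠ 0) (y : ℕ) (hgy : Good A (y + 1)) :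
    (thetaCore A 0 1 y).val = (Delta A (y + 1) / Delta A y) • (thetaCore A 0 0 y).val := by
  have hj := congrArg Mor.val (junction_zero hA y hgy)
  simp only [comp_val, cast_val, tens_val, smul_val, jw_zero, idm_val, tensR_zero_zero_idR_zero] at hj
  simp only [thetaCore, comp_val, cast_val, tens_val, idm_val, stdCaps_succ, stdCups_succ, stdCaps_zero,
    stdCups_zero, jw_zero, tensR_zero_zero_idR_zero, Nat.zero_add, Nat.add_zero]
  have hr : RespR y (capAt A (0 + y) 0).val := by simpa using (capAt A (0 + y) 0).respR
  have hc : RespC y (cupAt A (0 + y) 0).val := by simpa using (cupAt A (0 + y) 0).respC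
  simp only [show 0 + y + 2 = y + 2 by omega] at hj
  simp only [show 1 + (y + 1) = y + 2 by omega]
  rw [jw_val_congr (show 0 + 1 = 1 by omega), idR_compR hr, compR_idR hc, hj, smul_compR, idR_compR (jw A y).respR,
    compR_idR (jw A y).respC]

end Mor


namespace Mor

variable {A : K}

/-- The bent vertex with no through-strand on the left vanishes (raw): with `a = z'+1`, `b = y+z'+1`,
`c = y`, `(𝟙_{z'} ⊗ f_{b+1})(f_a ⊗ 𝟙_b) ∘ cups ∘ f_c = 0` (no admissible vertex `c → (a-1) ⊗ (b+1)`). [folklore] -/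
theorem bentW_zero_val (hA : A ≠ 0) (y z' : ℕ) (hgz : Good A (z' + 1)) (hgy : Good A (y + z' + 2)) (hgc : Good A y) :
    compR y (compR (z' + 1 + (y + z' + 1)) (compR (z' + 1 + (y + z' + 1))
      (tensR z' z' (idR z') (jw A (y + z' + 2)).val) (tensR (z' + 1) (z' + 1) (jw A (z' + 1)).val (idR (y + z' + 1))))
      (stdCups A 0 y (z' + 1)).val) (jw A y).val = 0 := by
  have hs := congrArg Mor.val (sandwich_eq_zero hA (a := z') (b := y + z' + 2) (c := y)
    (X := (((jw A (z' + 1) ⊗ₘ idm (y + z' + 1) :) ⊚ (stdCups A 0 y (z' + 1)).cast (Nat.zero_add y)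
      (show 0 + (z' + 1) + (y + (z' + 1)) = z' + 1 + (y + z' + 1) by omega)).cast rfl
      (show z' + 1 + (y + z' + 1) = z' + (y + z' + 2) by omega)))
    ((((IsTL.jw _).tens (IsTL.idm _)).comp _ ((IsTL.stdCups 0 y (z' + 1)).cast _ _)).cast _ _)
    (hgz.mono (Nat.le_succ _)) hgy hgc (fun x'' y'' z'' h1 h2 => by omega))
  have habs : ((jw A z' ⊗ₘ idm 1 :) ⊗ₘ idm (y + z' + 1) :) ⊚ (jw A (z' + 1) ⊗ₘ idm (y + z' + 1) :) =
      (jw A (z' + 1) ⊗ₘ idm (y + z' + 1) :) := by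
    rw [tens_idm_comp_tens_idm, jw_absorb_left hA hgz]
  have habs' := congrArg Mor.val habs
  simp only [comp_val, tens_val, idm_val] at habs'
  rw [← tensR_assoc (X := (jw A z').val) (n := z') (m := z') (n' := 1) (m' := 1), tensR_idR_idR,
    show 1 + (y + z' + 1) = y + z' + 2 by omega] at habs'
  have hsplit : tensR z' z' (jw A z').val (jw A (y + z' + 2)).val =
      compR (z' + 1 + (y + z' + 1)) (tensR z' z' (idR z') (jw A (y + z' + 2)).val)
        (tensR z' z' (jw A z').val (idR (y + z' + 2))) := by
    rw [show z' + 1 + (y + z' + 1) = z' + (y + z' + 2) by omega, compR_tensR_tensR (RespC.idR _) (jw A z').respR,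
      idR_compR (jw A z').respR, compR_idR (jw A (y + z' + 2)).respC]
  simp only [comp_val, cast_val, tens_val, idm_val, zero_val] at hs
  simp only [show z' + (y + z' + 2) = z' + 1 + (y + z' + 1) by omega] at hs
  rw [← habs', compR_assoc (tensR z' z' (idR z') (jw A (y + z' + 2)).val), ← hsplit, ← compR_assoc _ _ (stdCups A 0 y _).val]
  exact hs

/-- Core of `θ(0, z'+2, y)`: `= (Δ_{b+1}/Δ_b) · core of θ(0, z'+1, y)` (the second junction term dies). [folklore] -/
theorem thetaCore_zero_succ_succ_val (hA : A ≠ 0) (y z' : ℕ) (hgz : Good A (z' + 2)) (hgy : Good A (y + z' + 3))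
    (hgc : Good A y) :
    (thetaCore A 0 (z' + 2) y).val = (Delta A (y + z' + 2) / Delta A (y + z' + 1)) • (thetaCore A 0 (z' + 1) y).val := by
  have hj := congrArg Mor.val (junction_succ hA z' (y + z' + 1) (hgy.mono (by omega)))
  have h0 := bentW_zero_val hA y z' (hgz.mono (by omega)) (hgy.mono (by omega)) hgc
  simp only [comp_val, cast_val, tens_val, idm_val, sub_val, smul_val] at hj
  simp only [thetaCore]
  rw [stdCaps_succ A 0 y (z' + 1), stdCups_succ A 0 y (z' + 1)]
  simp only [comp_val, cast_val, tens_val]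
  simp only [Nat.zero_add, show y + (z' + 1 + 1) = y + z' + 2 by omega, show y + (z' + 1) = y + z' + 1 by omega,
    show z' + 1 + (y + z' + 1) + 2 = z' + 2 + (y + z' + 2) by omega, show y + z' + 1 + 1 = y + z' + 2 by omega] at hj ⊢
  rw [jw_val_congr (show y + z' + 1 + 1 = y + z' + 2 by omega)] at hj
  rw [jw_val_congr (show 0 + (z' + 2) = z' + 2 by omega), jw_val_congr (show y + (z' + 2) = y + z' + 2 by omega),
    jw_val_congr (show 0 + (z' + 1) = z' + 1 by omega), jw_val_congr (show y + (z' + 1) = y + z' + 1 by omega),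
    jw_val_congr (show 0 + y = y by omega),
    capAt_val_congr A (show 0 + (z' + 1) + (y + (z' + 1)) = z' + 1 + (y + z' + 1) by omega) (rfl : z' + 1 = _),
    cupAt_val_congr A (show 0 + (z' + 1) + (y + (z' + 1)) = z' + 1 + (y + z' + 1) by omega) (rfl : z' + 1 = _),
    ← compR_assoc (stdCaps A 0 y (z' + 1)).val (capAt A _ _).val _,
    ← compR_assoc (stdCaps A 0 y (z' + 1)).val _ (compR _ (cupAt A _ _).val _),
    compR_assoc (compR _ (capAt A _ _).val _) (cupAt A _ _).val (stdCups A 0 y (z' + 1)).val, hj,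
    sub_compR, smul_compR, smul_compR, compR_sub, compR_smul, compR_smul, sub_compR, smul_compR, smul_compR,
    ← compR_assoc (compR _ (tensR (z' + 1) (z' + 1) (jw A (z' + 1)).val (idR (y + z' + 1))) _) _ (stdCups A 0 y (z' + 1)).val,
    ← compR_assoc (tensR (z' + 1) (z' + 1) (jw A (z' + 1)).val (idR (y + z' + 1)))
      (tensR z' z' (idR z') (jw A (y + z' + 2)).val) _,
    compR_assoc (stdCaps A 0 y (z' + 1)).val (tensR (z' + 1) (z' + 1) (jw A (z' + 1)).val (idR (y + z' + 1))) _,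
    ← compR_assoc (compR _ (stdCaps A 0 y (z' + 1)).val _) _ (jw A y).val,
    compR_assoc (tensR z' z' (idR z') (jw A (y + z' + 2)).val) _ (stdCups A 0 y (z' + 1)).val, h0, compR_zero,
    smul_zero, sub_zero]
  simp only [compR_assoc]

end Mor


namespace Mor

variable {A : K}

/-- `θ(0, 1, y) = Δ_{y+1}`. [cite: MasbaumVogel1994, Thm 1] -/
theorem theta_zero_one (hA : A ≠ 0) (y : ℕ) (hgy : Good A (y + 2)) : theta A 0 1 y = Delta A (y + 1) := by
  rw [theta_eq_trAll_thetaCore hA 0 1 y (hgy.mono (by omega)) (hgy.mono (by omega)) (hgy.mono (by omega)),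
    trAll_eq_trW, thetaCore_zero_one_val hA y (hgy.mono (by omega)), trW_smul, ← trAll_eq_trW,
    ← theta_eq_trAll_thetaCore hA 0 0 y (hgy.mono (by omega)) (hgy.mono (by omega)) (hgy.mono (by omega)),
    theta_zero_mid hA 0 y (hgy.mono (by omega)), Nat.zero_add, div_mul_cancel₀ _ (hgy y (by omega))]

/-- `θ(0, z'+2, y) = (Δ_{y+z'+2}/Δ_{y+z'+1}) θ(0, z'+1, y)`. [cite: MasbaumVogel1994, Thm 1 (proof)] -/
theorem theta_zero_succ_succ (hA : A ≠ 0) (y z' : ℕ) (hgz : Good A (z' + 2)) (hgy : Good A (y + z' + 3)) :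
    theta A 0 (z' + 2) y = (Delta A (y + z' + 2) / Delta A (y + z' + 1)) * theta A 0 (z' + 1) y := by
  rw [theta_eq_trAll_thetaCore hA 0 (z' + 2) y (hgz.mono (by omega)) (hgy.mono (by omega)) (hgy.mono (by omega)),
    trAll_eq_trW, thetaCore_zero_succ_succ_val hA y z' hgz hgy (hgy.mono (by omega)), trW_smul, ← trAll_eq_trW,
    ← theta_eq_trAll_thetaCore hA 0 (z' + 1) y (hgz.mono (by omega)) (hgy.mono (by omega)) (hgy.mono (by omega))]

end Mor

/-! ### Quantum integers and factorials; the θ-net formula -/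


/-- `Δ_n = (-1)^n [n+1]`. [cite: KauffmanLins1994, §9.3] -/
theorem Delta_eq_qint (A : K) : ∀ n : ℕ, Delta A n = (-1) ^ n * qint A (n + 1)
  | 0 => by simp
  | 1 => by rw [Delta_one, qint_succ_succ, qint_one, qint_zero, dval]; ring
  | n + 2 => by
    rw [Delta_succ_succ, Delta_eq_qint A n, Delta_eq_qint A (n + 1), qint_succ_succ A (n + 1), dval]
    ring

/-- Closed form: `[n](A² - A⁻²) = A^{2n} - A^{-2n}`. [cite: KauffmanLins1994, §9.3] -/
theorem qint_mul_eq (A : K) (hA : A ≠ 0) : ∀ n : ℕ, qint A n * (A ^ 2 - A⁻¹ ^ 2) = A ^ (2 * n) - A⁻¹ ^ (2 * n)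
  | 0 => by simp
  | 1 => by simp
  | n + 2 => by
    have h1 := qint_mul_eq A hA (n + 1)
    have h0 := qint_mul_eq A hA n
    have hu : A ^ 2 * A⁻¹ ^ 2 = 1 := by rw [← mul_pow, mul_inv_cancel₀ hA, one_pow]
    rw [qint_succ_succ, sub_mul, mul_assoc, h1, h0, show 2 * (n + 2) = 2 * n + 2 + 2 by ring,
      show 2 * (n + 1) = 2 * n + 2 by ring, pow_add, pow_add, pow_add, pow_add]
    linear_combination (A ^ (2 * n) - A⁻¹ ^ (2 * n)) * hu

/-- **Lemma 3** of Masbaum–Vogel: `[n+r][m+r] = [n][m] + [n+m+r][r]` (for `A⁴ ≠ 1`). [cite: MasbaumVogel1994, Lemma 3] -/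
theorem qint_lemma3 (A : K) (hA : A ≠ 0) (hq : A ^ 2 - A⁻¹ ^ 2 ≠ 0) (n m r : ℕ) :
    qint A (n + r) * qint A (m + r) = qint A n * qint A m + qint A (n + m + r) * qint A r := by
  have key : ∀ k : ℕ, qint A k = (A ^ (2 * k) - A⁻¹ ^ (2 * k)) / (A ^ 2 - A⁻¹ ^ 2) := fun k => by
    rw [eq_div_iff hq, qint_mul_eq A hA k]
  have hu : ∀ k : ℕ, A ^ (2 * k) * A⁻¹ ^ (2 * k) = 1 := fun k => by rw [← mul_pow, mul_inv_cancel₀ hA, one_pow]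
  rw [key, key, key, key, key, key, div_mul_div_comm, div_mul_div_comm, div_mul_div_comm, ← add_div,
    div_left_inj' (mul_ne_zero hq hq)]
  rw [show 2 * (n + r) = 2 * n + 2 * r by ring, show 2 * (m + r) = 2 * m + 2 * r by ring,
    show 2 * (n + m + r) = 2 * n + 2 * m + 2 * r by ring, pow_add, pow_add, pow_add, pow_add, pow_add, pow_add, pow_add,
    pow_add]
  linear_combination (A ^ (2 * n) * A ^ (2 * m) + A⁻¹ ^ (2 * n) * A⁻¹ ^ (2 * m) - A ^ (2 * n) * A⁻¹ ^ (2 * m)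
    - A⁻¹ ^ (2 * n) * A ^ (2 * m)) * hu r

/-- Bookkeeping lemma `qint_ne_zero_of_good` of the binor tensor model of Temperley–Lieb recoupling theory (conventions of KL94 §8.2, §9). [folklore] -/
theorem qint_ne_zero_of_good {A : K} {N k : ℕ} (hg : Good A N) (hk : 1 ≤ k) (hkN : k ≤ N) : qint A k ≠ 0 := by
  obtain ⟨m, rfl⟩ : ∃ m, k = m + 1 := ⟨k - 1, by omega⟩
  have h := hg m (by omega)
  rw [Delta_eq_qint] at h
  exact right_ne_zero_of_mul h

/-- Bookkeeping lemma `qfact_ne_zero_of_good` of the binor tensor model of Temperley–Lieb recoupling theory (conventions of KL94 §8.2, §9). [folklore] -/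
theorem qfact_ne_zero_of_good {A : K} {N : ℕ} (hg : Good A N) : ∀ {n : ℕ}, n ≤ N → qfact A n ≠ 0
  | 0, _ => one_ne_zero
  | n + 1, h => mul_ne_zero (qfact_ne_zero_of_good hg (by omega)) (qint_ne_zero_of_good hg (by omega) h)


namespace Mor

variable {A : K}

/-- `θ(0, z, y) = Δ_{y+z}` (the net collapses onto the big projector). [cite: MasbaumVogel1994, Thm 1] -/
theorem theta_zero_left (hA : A ≠ 0) (y : ℕ) : ∀ z : ℕ, Good A (y + z + 1) → theta A 0 z y = Delta A (y + z)
  | 0 => fun hg => by rw [theta_zero_mid hA 0 y (by simpa using hg), Nat.zero_add, Nat.add_zero]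
  | 1 => fun hg => theta_zero_one hA y hg
  | z' + 2 => fun hg => by
    rw [theta_zero_succ_succ hA y z' (hg.mono (by omega)) (hg.mono (by omega)),
      theta_zero_left hA y (z' + 1) (hg.mono (by omega)), show y + (z' + 1) = y + z' + 1 by omega,
      div_mul_cancel₀ _ (hg _ (by omega)), show y + (z' + 2) = y + z' + 2 by omega]

/-- Bookkeeping lemma `lam_eq_qint` of the binor tensor model of Temperley–Lieb recoupling theory (conventions of KL94 §8.2, §9). [folklore] -/
theorem lam_eq_qint (x' z : ℕ) (h : qint A (x' + z + 1) ≠ 0) : lam A x' z = qint A (x' + 1) / qint A (x' + z + 1) := by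
  rw [lam, Delta_eq_qint, Delta_eq_qint, pow_add]
  field_simp

/-- **The θ-net formula** (Masbaum–Vogel Thm 1 / Kauffman–Lins §9.10), multiplied out:
`θ(x,z,y) · [x+z]! [y+z]! [x+y]! = (-1)^{x+y+z} [x+y+z+1]! [x]! [y]! [z]!`.
[cite: MasbaumVogel1994, Thm 1; KauffmanLins1994, §6.3 Cor. 2, §9.10] -/
theorem theta_formula (hA : A ≠ 0) (hq : A ^ 2 - A⁻¹ ^ 2 ≠ 0) : ∀ (z x y : ℕ), Good A (x + y + z + 1) →
    theta A x z y * (qfact A (x + z) * qfact A (y + z) * qfact A (x + y)) =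
      (-1) ^ (x + y + z) * qfact A (x + y + z + 1) * qfact A x * qfact A y * qfact A z := by
  intro z
  induction z with
  | zero =>
    intro x y hg
    rw [theta_zero_mid hA x y (by simpa using hg), Delta_eq_qint]
    simp only [Nat.add_zero, qfact_succ, qfact_zero]
    ring
  | succ z IH =>
    intro x y hg
    cases x with
    | zero =>
      rw [theta_zero_left hA y (z + 1) (by simpa [Nat.add_comm, Nat.add_left_comm, Nat.add_assoc] using hg), Delta_eq_qint]
      simp only [Nat.zero_add, qfact_zero,
        show 0 + (z + 1) = z + 1 from Nat.zero_add _, show y + (z + 1) = y + z + 1 by omega, qfact_succ]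
      ring
    | succ x' =>
      have hL3 := qint_lemma3 A hA hq (x' + 1) (y + 1) (z + 1)
      have h1 := IH (x' + 1) y (hg.mono (by omega))
      have h2 := IH x' (y + 1) (hg.mono (by omega))
      have hb1 : qint A (y + z + 1) ≠ 0 := qint_ne_zero_of_good hg (by omega) (by omega)
      have ha1 : qint A (x' + z + 1) ≠ 0 := qint_ne_zero_of_good hg (by omega) (by omega)
      have ha2 : qint A (x' + z + 2) ≠ 0 := qint_ne_zero_of_good hg (by omega) (by omega)
      have hc1 : Delta A (y + z + 1) / Delta A (y + z) * qint A (y + z + 1) = -qint A (y + z + 2) := by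
        rw [Delta_eq_qint, Delta_eq_qint, pow_succ]
        field_simp
      have hc2 : Delta A (x' + z) / Delta A (x' + z + 1) * lam A x' z ^ 2 * (qint A (x' + z + 1) * qint A (x' + z + 2)) =
          -qint A (x' + 1) ^ 2 := by
        rw [Delta_eq_qint, Delta_eq_qint, lam_eq_qint x' z ha1, pow_succ]
        field_simp
      rw [theta_succ_succ hA x' y z (hg.mono (by omega)) (hg.mono (by omega)) (hg.mono (by omega))]
      simp only [show x' + 1 + z = x' + z + 1 by omega, show x' + 1 + (z + 1) = x' + z + 2 by omega,
        show y + (z + 1) = y + z + 1 by omega, show y + 1 + (z + 1) = y + z + 2 by omega,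
        show y + 1 + z = y + z + 1 by omega, show x' + (y + 1) = x' + y + 1 by omega,
        show x' + 1 + y = x' + y + 1 by omega, show x' + 1 + (y + 1) = x' + y + 2 by omega,
        show x' + y + 1 + z = x' + y + z + 1 by omega, show x' + y + 1 + (z + 1) = x' + y + z + 2 by omega,
        show x' + y + 2 + (z + 1) = x' + y + z + 3 by omega, show x' + y + z + 1 + 1 = x' + y + z + 2 by omega,
        show x' + y + z + 2 + 1 = x' + y + z + 3 by omega] at h1 h2 hL3 ⊢
      simp only [qfact_succ] at h1 h2 ⊢
      simp only [show x' + z + 1 + 1 = x' + z + 2 by omega,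
        show x' + y + z + 1 + 1 = x' + y + z + 2 by omega, show x' + y + z + 2 + 1 = x' + y + z + 3 by omega] at h1 h2 ⊢
      linear_combination (Delta A (y + z + 1) / Delta A (y + z) * qint A (x' + z + 2) * qint A (y + z + 1)) * h1
        - (Delta A (x' + z) / Delta A (x' + z + 1) * lam A x' z ^ 2 * (qint A (x' + z + 1) * qint A (x' + z + 2))) * h2
        + ((-1) ^ (x' + 1 + y + z) * (qfact A (x' + y + z) * qint A (x' + y + z + 1)) * qint A (x' + y + z + 2) *
            (qfact A x' * qint A (x' + 1)) * qfact A y * qfact A z * qint A (x' + z + 2)) * hc1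
        - ((-1) ^ (x' + (y + 1) + z) * (qfact A (x' + y + z) * qint A (x' + y + z + 1)) * qint A (x' + y + z + 2) *
            qfact A x' * (qfact A y * qint A (y + 1)) * qfact A z) * hc2
        + ((-1) ^ (x' + y + z) * (qfact A (x' + y + z) * qint A (x' + y + z + 1)) * qint A (x' + y + z + 2) * qfact A x' *
            qfact A y * qfact A z * qint A (x' + 1)) * hL3

end Mor


/-! ### Morphisms through small projectors: the decomposition of the identity -/



namespace thruSpan

variable {A : K} {J : ℕ}

/-- Bookkeeping lemma `gen_mem` of the binor tensor model of Temperley–Lieb recoupling theory (conventions of KL94 §8.2, §9). [folklore] -/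
theorem gen_mem {J j : ℕ} (hj : j < J) {P : Mor K j n} {Q : Mor K m j} (hP : IsTL A P) (hQ : IsTL A Q) :
    P ⊚ jw A j ⊚ Q ∈ thruSpan A J m n :=
  Submodule.subset_span ⟨j, P, Q, hj, hP, hQ, rfl⟩

/-- Bookkeeping lemma `mono` of the binor tensor model of Temperley–Lieb recoupling theory (conventions of KL94 §8.2, §9). [folklore] -/
theorem mono {J J' : ℕ} (h : J ≤ J') : thruSpan A J m n ≤ thruSpan A J' m n := by
  apply Submodule.span_mono
  rintro _ ⟨j, P, Q, hj, hP, hQ, rfl⟩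
  exact ⟨j, P, Q, lt_of_lt_of_le hj h, hP, hQ, rfl⟩

/-- Bookkeeping lemma `isTL` of the binor tensor model of Temperley–Lieb recoupling theory (conventions of KL94 §8.2, §9). [folklore] -/
theorem isTL {X : Mor K m n} (h : X ∈ thruSpan A J m n) : IsTL A X := by
  induction h using Submodule.span_induction with
  | mem _ hx =>
    obtain ⟨j, P, Q, _, hP, hQ, rfl⟩ := hx
    exact (hP.comp _ (IsTL.jw j)).comp _ hQ
  | zero => exact IsTL.zero
  | add _ _ _ _ h1 h2 => exact h1.add _ _ h2
  | smul c _ _ h => exact h.smul c _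

/-- Bookkeeping lemma `comp_mem` of the binor tensor model of Temperley–Lieb recoupling theory (conventions of KL94 §8.2, §9). [folklore] -/
theorem comp_mem {X : Mor K m n} (h : X ∈ thruSpan A J m n) {Z : Mor K n p} (hZ : IsTL A Z) :
    Z ⊚ X ∈ thruSpan A J m p := by
  have key : thruSpan A J m n ≤ (thruSpan A J m p).comap (compLeftL Z) := by
    rw [thruSpan, Submodule.span_le]
    rintro _ ⟨j, P, Q, hj, hP, hQ, rfl⟩
    simp only [Submodule.comap_coe, Set.mem_preimage, compLeftL_apply, SetLike.mem_coe, comp_assoc]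
    exact gen_mem hj (hZ.comp _ hP) hQ
  exact key h

/-- Bookkeeping lemma `mem_comp` of the binor tensor model of Temperley–Lieb recoupling theory (conventions of KL94 §8.2, §9). [folklore] -/
theorem mem_comp {X : Mor K m n} (h : X ∈ thruSpan A J m n) {Z : Mor K p m} (hZ : IsTL A Z) :
    X ⊚ Z ∈ thruSpan A J p n := by
  have key : thruSpan A J m n ≤ (thruSpan A J p n).comap (compRightL Z) := by
    rw [thruSpan, Submodule.span_le]
    rintro _ ⟨j, P, Q, hj, hP, hQ, rfl⟩
    simp only [Submodule.comap_coe, Set.mem_preimage, compRightL_apply, SetLike.mem_coe]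
    rw [← comp_assoc]
    exact gen_mem hj hP (hQ.comp _ hZ)
  exact key h

/-- Bookkeeping lemma `cast_mem` of the binor tensor model of Temperley–Lieb recoupling theory (conventions of KL94 §8.2, §9). [folklore] -/
theorem cast_mem {X : Mor K m n} (h : X ∈ thruSpan A J m n) (hm : m = m') (hn : n = n') :
    X.cast hm hn ∈ thruSpan A J m' n' := by
  subst hm hn; exact h

/-- Tensoring with one strand stays in the span, one projector size up — given the decomposition of the
identity in the sizes below `J`. [folklore] -/
theorem tens_idm_one_mem (hA : A ≠ 0) {J : ℕ} (hg : Good A J)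
    (hS : ∀ i, i < J → idm (i + 1) - jw A (i + 1) ∈ thruSpan A (i + 1) (i + 1) (i + 1))
    {X : Mor K m n} (h : X ∈ thruSpan A J m n) : X ⊗ₘ idm 1 ∈ thruSpan A (J + 1) (m + 1) (n + 1) := by
  have key : thruSpan A J m n ≤ (thruSpan A (J + 1) (m + 1) (n + 1)).comap (tensIdmL m n 1) := by
    rw [thruSpan, Submodule.span_le]
    rintro _ ⟨j, P, Q, hj, hP, hQ, rfl⟩
    simp only [Submodule.comap_coe, Set.mem_preimage, tensIdmL_apply, SetLike.mem_coe]
    rw [← tens_idm_comp_tens_idm, ← tens_idm_comp_tens_idm]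
    -- `f_j ⊗ 𝟙 = f_{j+1} + (f_j ⊗ 𝟙)(𝟙_{j+1} - f_{j+1})`
    have e : (jw A j ⊗ₘ idm 1 :) = jw A (j + 1) + (jw A j ⊗ₘ idm 1 :) ⊚ (idm (j + 1) - jw A (j + 1)) := by
      rw [comp_sub, comp_idm, jw_absorb_left hA (hg.mono hj), add_sub_cancel]
    rw [e, comp_add, add_comp]
    refine Submodule.add_mem _ (gen_mem (by omega) (hP.tens_idm 1) (hQ.tens_idm 1)) ?_
    have h1 : (jw A j ⊗ₘ idm 1 :) ⊚ (idm (j + 1) - jw A (j + 1)) ∈ thruSpan A (J + 1) (j + 1) (j + 1) :=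
      mono (by omega) (comp_mem (hS j hj) ((IsTL.jw j).tens_idm 1))
    exact mem_comp (comp_mem h1 (hP.tens_idm 1)) (hQ.tens_idm 1)
  exact key h

end thruSpan

namespace Mor

variable {A : K}

/-- **Decomposition of the identity**: `𝟙_n - f_n` is a combination of Temperley–Lieb morphisms
factoring through smaller projectors, `𝟙_n = f_n + Σ P f_j Q` (`j < n`).
[cite: KauffmanLins1994, §7.1 (proof of Lemma 17), §3.2] -/
theorem idm_sub_jw_mem_thruSpan (hA : A ≠ 0) : ∀ n : ℕ, Good A n → idm n - jw A n ∈ thruSpan A n n n := by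
  intro n
  induction n using Nat.strong_induction_on with
  | _ n IH =>
    intro hg
    match n, IH, hg with
    | 0, _, _ => rw [jw_zero, sub_self]; exact Submodule.zero_mem _
    | 1, _, _ => rw [jw_one, sub_self]; exact Submodule.zero_mem _
    | n + 2, IH, hg =>
      have hS : ∀ i, i < n + 1 → idm (i + 1) - jw A (i + 1) ∈ thruSpan A (i + 1) (i + 1) (i + 1) :=
        fun i hi => IH (i + 1) (by omega) (hg.mono (by omega))
      rw [jw_succ_succ, ← sub_add, ← idm_tens_idm (n + 1) 1, ← sub_tens]
      refine Submodule.add_mem _ ?_ (Submodule.smul_mem _ _ ?_)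
      · exact thruSpan.tens_idm_one_mem hA (hg.mono (by omega)) hS (IH (n + 1) (by omega) (hg.mono (by omega)))
      · -- the turn-back passes through `n` strands: `𝟙_n = f_n + (𝟙_n - f_n)`
        have e : (jw A (n + 1) ⊗ₘ idm 1 :) ⊚ (idm n ⊗ₘ U A :) ⊚ (jw A (n + 1) ⊗ₘ idm 1 :) =
            ((jw A (n + 1) ⊗ₘ idm 1 :) ⊚ (idm n ⊗ₘ cup A :)).cast (Nat.add_zero n) rfl ⊚ jw A n ⊚
              ((idm n ⊗ₘ cap A :) ⊚ (jw A (n + 1) ⊗ₘ idm 1 :)).cast rfl (Nat.add_zero n) +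
            ((jw A (n + 1) ⊗ₘ idm 1 :) ⊚ (idm n ⊗ₘ cup A :)).cast (Nat.add_zero n) rfl ⊚ (idm n - jw A n) ⊚
              ((idm n ⊗ₘ cap A :) ⊚ (jw A (n + 1) ⊗ₘ idm 1 :)).cast rfl (Nat.add_zero n) := by
          rw [comp_sub, sub_comp, comp_idm, add_sub_cancel, cast_comp_cast, idm_tens_U]
          apply ext'
          simp only [comp_val, cast_val, compR_assoc]
        rw [e]
        have hP : IsTL A (((jw A (n + 1) ⊗ₘ idm 1 :) ⊚ (idm n ⊗ₘ cup A :)).cast (Nat.add_zero n) rfl) :=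
          (((IsTL.jw (n + 1)).tens_idm 1).comp _ ((IsTL.idm n).tens (IsTL.cup (A := A)))).cast _ _
        have hQ : IsTL A (((idm n ⊗ₘ cap A :) ⊚ (jw A (n + 1) ⊗ₘ idm 1 :)).cast rfl (Nat.add_zero n)) :=
          (((IsTL.idm n).tens (IsTL.cap (A := A))).comp _ ((IsTL.jw (n + 1)).tens_idm 1)).cast _ _
        refine Submodule.add_mem _ (thruSpan.gen_mem (by omega) hP hQ) ?_
        exact thruSpan.mem_comp (thruSpan.comp_mem (thruSpan.mono (by omega)
          (IH n (by omega) (hg.mono (by omega)))) hP) hQ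

/-- The identity decomposes through projectors of size `≤ n`: `𝟙_n ∈ span{P f_j Q : j ≤ n}`. [folklore] -/
theorem idm_mem_thruSpan (hA : A ≠ 0) (n : ℕ) (hg : Good A n) : (idm n : Mor K n n) ∈ thruSpan A (n + 1) n n := by
  have h : (idm n : Mor K n n) = (idm n - jw A n) + idm n ⊚ jw A n ⊚ idm n := by
    rw [idm_comp, comp_idm, sub_add_cancel]
  rw [h]
  exact Submodule.add_mem _ (thruSpan.mono (Nat.le_succ n) (idm_sub_jw_mem_thruSpan hA n hg))
    (thruSpan.gen_mem (Nat.lt_succ_self n) (IsTL.idm n) (IsTL.idm n))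

end Mor

end TemperleyLieb

end Literature.RepresentationTheory.ModularTensorCategories
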